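import Literature.NumberTheory.Irrationality.CressonFischlerRivoal2008.WellPoisedSymmetry
import Literature.NumberTheory.Irrationality.BrownZudilin2022.TotallySymmetric
import HarnessLib

/-!
# Zudilin 2002, Sect. 2: the very-well-poised forms `rₙ, r̃ₙ` and Theorem 1 from the identities (15)

Source: W. Zudilin, *A third-order Apéry-like recursion for ζ(5)*, Mat. Zametki **72** (2002) 796–800 =
Math. Notes **72** (2002) 733–737, arXiv:math/0206178 [Zudilin2002Zeta5], Sect. 2 ("Auxiliary recursions"),
eqs. (7), (10), (12), (14)–(15) and the last paragraph of Sect. 2 (Theorem 1 from Theorems 2–3 and (15)).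

HONEST FRAMING (cell `pub-zeta5`): systematic search; no irrationality claim unless certified. Nothing in
this file says anything about the arithmetic nature of `ζ(5)`.

What is typed and PROVED here (0 sorry, no named facts):

* the very-well-poised hypergeometric series (7)
  `rₙ = n!⁴ Σ_{k≥1} (k + n/2) (k−1)⋯(k−n)·(k+n+1)⋯(k+2n) / (k(k+1)⋯(k+n))⁶` and
  `r̃ₙ = −n!⁴ Σ_{k≥1} (k + n/2) k(k−1)⋯(k−n)·(k+n)(k+n+1)⋯(k+2n) / (k(k+1)⋯(k+n))⁶`
  (`rForm n`, `rtForm n`, real `tsum`s of the summands `numR n`, `numRt n ∈ ℚ[X]` over `(k)_{n+1}⁶`);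
* "are ℚ-linear forms in `1, ζ(3), ζ(5)`": `rₙ = uₙζ(5) + wₙζ(3) − vₙ`, `r̃ₙ = ũₙζ(5) + w̃ₙζ(3) − ṽₙ`
  (`rForm_eq`, `rtForm_eq`) with the coefficients DEFINED by the hypergeometric construction — the sums of
  the partial-fraction coefficients of the summand of orders 5 and 3 and the harmonic-number constant term
  (`uC wC vC`, `utC wtC vtC`; Cresson–Fischler–Rivoal's Théorème 1 with explicit coefficients, `A = 6`, the
  even zeta values being killed by the well-poised reflection `numR_reflect`); for ANY partial-fraction data
  the same sums come out (`uC_eq`, …, by uniqueness of partial fractions);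
* the sign statements `rₙ > 0`, `r̃ₙ < 0` of (10), (12) (`rForm_pos`, `rtForm_neg`), the first values
  `r₀ = ζ(5)`, `r̃₀ = −ζ(3)`, `r₁ = 9ζ(5)+33ζ(3)−49`, `r̃₁ = 2ζ(5)+12ζ(3)−33/2` from explicit data (`values_zero`,
  `values_one`, `rForm_zero`; the source prints `r̃₀ = ζ(3)`, a sign misprint: with the displayed (7) one has
  `r̃₀ = −Σ k³/k⁶ = −ζ(3)`, and only this sign is consistent with `q₀ = −1` in (15)), and (15) CHECKED at
  `n = 0, 1` against the tree's `q, p, ptilde` (`eq15_zero_one`);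
* explicit CRUDE estimates sufficient for limits: `R_n(k) ≤ (n+1)⁴/(128ⁿ(k+1)⁶)` on `ℕ` (`R_natCast_le_decay`),
  `0 < rₙ ≤ (3/2)ζ(2)(n+1)⁴/128ⁿ`, `0 < −r̃ₙ ≤ 3ζ(2)(n+1)⁴/128ⁿ` (`rForm_le`, `neg_rtForm_le`), and
  `|uₙ|, |wₙ|, |ũₙ|, |w̃ₙ| ≤ 720(n+1)³·64ⁿ·C(2n,n)² ≤ 720(n+1)³·1024ⁿ` (`abs_coeff_le`, via explicit bounded data
  `exists_data_l1_le`) from the Ball–Rivoal brick bound `BallRivoal.exists_pf_R` and two multiplications by linear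
  factors (the source proves the sharp rates (11), (13) instead; not needed below);
* **Theorem 1 from (15)** (`tendsto_of_eq15`): IF the three solutions `qₙ, pₙ, p̃ₙ` of the recursion (1)
  (tree: `Zudilin2002.q/p/ptilde`) satisfy (15) `qₙ = uₙw̃ₙ − ũₙwₙ`, `pₙ = w̃ₙvₙ − wₙṽₙ`, `p̃ₙ = uₙṽₙ − ũₙvₙ`
  for all large `n`, and Brown–Zudilin's `Q_solvesRec` holds (a named fact of `TotallySymmetric.lean`,
  DISCHARGED in the tree by `Summit.KontsevichZagierPeriods.Zeta5Search.SymmetricRecursion.Q_solvesRec_holds`;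
  it gives `|qₙ| = C(2n,n)·Qₙ ≥ C(2n,n)³`), THEN `pₙ/qₙ → ζ(5)` and `p̃ₙ/qₙ → ζ(3)` — by the printed route
  `ℓₙ = w̃ₙrₙ − wₙr̃ₙ = qₙζ(5) − pₙ`, `ℓ̃ₙ = uₙr̃ₙ − ũₙrₙ = qₙζ(3) − p̃ₙ` and the estimates above
  (`|ℓₙ| ≤ c·(n+1)⁷·8ⁿ` against `|qₙ| ≥ 64ⁿ/(2n+1)³`);
* the same with (15) replaced by "the three minors `uₙw̃ₙ − ũₙwₙ`, `w̃ₙvₙ − wₙṽₙ`, `uₙṽₙ − ũₙvₙ` solve the recursion (1)"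
  (`minorQ/minorP/minorPt`, `eq15_of_isSolution`, `tendsto_of_minors_isSolution`): the initial values `n = 0, 1, 2`
  are checked here (`values_zero/one/two`, `eq15_zero_one`, `eq15_two`), so uniqueness of solutions gives (15) for all `n`.

The identities (15) themselves ("Applying the algorithm of creative telescoping … we arrive at (8), (9)" +
Theorems 2, 3) are the cell's symmetric-ray creative-telescoping programme (Summit side); with them and this
file the named facts `theorem1_rates`, `theorem1_signs` of `Recursion.lean` follow through the tree's
`theorem1_rates_of_tendsto`, `theorem1_signs_of_tendsto`.
-/

noncomputable section

open Finset Polynomial Filter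
open scoped _root_.Topology

namespace Literature.NumberTheory.Irrationality.Zudilin2002

open Literature.NumberTheory.Transcendental (zetaValue)
open Literature.NumberTheory.Transcendental.BallRivoal (pfEval l1 pf_unique pfEval_sub' pfEval_const_mul
  pfEval_add poch pochPoly eval_pochPoly poch_reflect poch_mul poch_pos poch_natCast_succ harm R exists_pf_R
  sum_c_zero_eq_zero
  R_natCast_eq_zero R_natCast_nonneg hasSum_one_div_pow_shift)
open Literature.NumberTheory.Irrationality.CressonFischlerRivoal2008 (exists_pf_data hasSum_of_pf_data
  sum_pf_data_odd partialFractions_sum_order_zero)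

/-! ### The summands of (7) as polynomials over `(k)_{n+1}⁶` -/

/-- The numerator of the summand of `rₙ` in (7), as a polynomial in `k`:
`numR n = n!⁴ (X + n/2) · (X−n)(X−n+1)⋯(X−1) · (X+n+1)⋯(X+2n)`. [cite: Zudilin2002Zeta5, Sect. 2, eq. (7)] -/
def numR (n : ℕ) : ℚ[X] :=
  C ((n.factorial : ℚ) ^ 4) * (X + C ((n : ℚ) / 2)) * (pochPoly (-(n : ℚ)) n * pochPoly ((n : ℚ) + 1) n)

/-- The numerator of the summand of `r̃ₙ` in (7): the extra factors `k` and `k+n` and the sign,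
`numRt n = −X(X+n) · numR n`. [cite: Zudilin2002Zeta5, Sect. 2, eq. (7)] -/
def numRt (n : ℕ) : ℚ[X] := -(X * (X + C (n : ℚ))) * numR n

/-- `numR n (x) = n!⁴ (x + n/2) (x−n)_n (x+n+1)_n`. [cite: Zudilin2002Zeta5, Sect. 2, eq. (7)] -/
theorem eval_numR (n : ℕ) (x : ℚ) :
    (numR n).eval x = (n.factorial : ℚ) ^ 4 * (x + n / 2) * (poch (x - n) n * poch (x + n + 1) n) := by
  rw [numR, eval_mul, eval_mul, eval_mul, eval_C, eval_add, eval_X, eval_C, eval_pochPoly, eval_pochPoly,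
    ← sub_eq_add_neg, ← add_assoc]

/-- `numRt n (x) = −x(x+n) · numR n (x)`. [cite: Zudilin2002Zeta5, Sect. 2, eq. (7)] -/
theorem eval_numRt (n : ℕ) (x : ℚ) : (numRt n).eval x = -(x * (x + n)) * (numR n).eval x := by
  rw [numRt, eval_mul, eval_neg, eval_mul, eval_add, eval_X, eval_C]

/-- `deg numR n ≤ 2n + 1`. [cite: Zudilin2002Zeta5, Sect. 2, eq. (7)] -/
theorem natDegree_numR_le (n : ℕ) : (numR n).natDegree ≤ 2 * n + 1 := by
  have hp : ∀ β : ℚ, (pochPoly β n).natDegree ≤ n := fun β => by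
    unfold pochPoly
    refine (natDegree_prod_le _ _).trans ?_
    refine (sum_le_sum fun s _ => (natDegree_X_add_C _).le).trans ?_
    simp
  unfold numR
  refine natDegree_mul_le.trans ?_
  have h1 : (C ((n.factorial : ℚ) ^ 4) * (X + C ((n : ℚ) / 2))).natDegree ≤ 1 :=
    (natDegree_C_mul_le _ _).trans (natDegree_X_add_C _).le
  have h2 : (pochPoly (-(n : ℚ)) n * pochPoly ((n : ℚ) + 1) n).natDegree ≤ n + n :=
    natDegree_mul_le.trans (add_le_add (hp _) (hp _))
  omega

/-- `deg numRt n ≤ 2n + 3`. [cite: Zudilin2002Zeta5, Sect. 2, eq. (7)] -/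
theorem natDegree_numRt_le (n : ℕ) : (numRt n).natDegree ≤ 2 * n + 3 := by
  unfold numRt
  refine natDegree_mul_le.trans ?_
  have h1 : (-(X * (X + C (n : ℚ)))).natDegree ≤ 2 := by
    rw [natDegree_neg]
    refine natDegree_mul_le.trans ?_
    rw [natDegree_X, natDegree_X_add_C]
  have h2 := natDegree_numR_le n
  omega

/-- The WELL-POISED REFLECTION for `rₙ`: `numR n (−n−X) = −numR n (X) = (−1)^{6(n+1)+1} numR n (X)` (the
symmetry hypothesis of Cresson–Fischler–Rivoal's Théorème 1 with `A = 6`). [cite: Zudilin2002Zeta5, Sect. 2 (very-well-poised series (7))] -/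
theorem numR_reflect (n : ℕ) :
    (numR n).comp (-(n : ℚ[X]) - X) = (-1 : ℚ[X]) ^ (6 * (n + 1) + 1) * numR n := by
  apply Polynomial.funext
  intro x
  rw [eval_comp, eval_sub, eval_neg, eval_natCast, eval_X, eval_mul, eval_pow, eval_neg, eval_one,
    Odd.neg_one_pow ⟨3 * (n + 1), by ring⟩, eval_numR, eval_numR, neg_one_mul]
  have h1 := poch_reflect (x + n + 1) n
  rw [show -(x + n + 1) - (n : ℚ) + 1 = -n - x - n by ring] at h1
  have h2 := poch_reflect (x - n) n
  rw [show -(x - n) - (n : ℚ) + 1 = -n - x + n + 1 by ring] at h2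
  rw [h1, h2]
  have hsq : ((-1 : ℚ) ^ n) * (-1) ^ n = 1 := by
    rw [← pow_add, ← two_mul, pow_mul]
    norm_num
  linear_combination (-((n.factorial : ℚ) ^ 4 * (x + n / 2) * (poch (x + n + 1) n * poch (x - n) n))) * hsq

/-- The WELL-POISED REFLECTION for `r̃ₙ`: `numRt n (−n−X) = (−1)^{6(n+1)+1} numRt n (X)` (the extra factor
`X(X+n)` is reflection-invariant). [cite: Zudilin2002Zeta5, Sect. 2 (very-well-poised series (7))] -/
theorem numRt_reflect (n : ℕ) :
    (numRt n).comp (-(n : ℚ[X]) - X) = (-1 : ℚ[X]) ^ (6 * (n + 1) + 1) * numRt n := by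
  have h := numR_reflect n
  have hn : (C (n : ℚ) : ℚ[X]) = (n : ℚ[X]) := map_natCast C n
  rw [numRt, hn, mul_comp, h, neg_comp, mul_comp, add_comp, X_comp, natCast_comp]
  ring

/-! ### Partial-fraction data and the coefficients `u, w, v`, `ũ, w̃, ṽ` -/

/-- `c` is partial-fraction data of the summand of `rₙ`: away from the poles,
`numR n (t+1)/(t+1)_{n+1}⁶ = Σ_{p≤n} Σ_{o<6} c_{o,p}/(t+p+1)^{o+1}`. [cite: Zudilin2002Zeta5, Sect. 2 (construction of (7))] -/
def IsDataR (n : ℕ) (c : ℕ → ℕ → ℚ) : Prop :=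
  ∀ t : ℚ, (∀ p, p ≤ n → t + p + 1 ≠ 0) →
    pfEval n 6 c t = ((numR n).comp (X + C 1)).eval t / poch (t + 1) (n + 1) ^ 6

/-- `c` is partial-fraction data of the summand of `r̃ₙ`. [cite: Zudilin2002Zeta5, Sect. 2 (construction of (7))] -/
def IsDataRt (n : ℕ) (c : ℕ → ℕ → ℚ) : Prop :=
  ∀ t : ℚ, (∀ p, p ≤ n → t + p + 1 ≠ 0) →
    pfEval n 6 c t = ((numRt n).comp (X + C 1)).eval t / poch (t + 1) (n + 1) ^ 6

/-- Degree bookkeeping: `deg numR n + 2 ≤ 6(n+1)`. [cite: Zudilin2002Zeta5, Sect. 2, eq. (7)] -/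
theorem natDegree_numR_add_two_le (n : ℕ) : (numR n).natDegree + 2 ≤ 6 * (n + 1) := by
  have := natDegree_numR_le n
  omega

/-- Degree bookkeeping: `deg numRt n + 2 ≤ 6(n+1)`. [cite: Zudilin2002Zeta5, Sect. 2, eq. (7)] -/
theorem natDegree_numRt_add_two_le (n : ℕ) : (numRt n).natDegree + 2 ≤ 6 * (n + 1) := by
  have := natDegree_numRt_le n
  omega

/-- Existence of partial-fraction data for `rₙ` (`CressonFischlerRivoal2008.exists_pf_data`).
[cite: Zudilin2002Zeta5, Sect. 2 (construction of (7))] -/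
theorem exists_isDataR (n : ℕ) : ∃ c, IsDataR n c := by
  have hQ : ((numR n).comp (X + C 1)).degree < ((6 * (n + 1) : ℕ) : WithBot ℕ) := by
    have hnat : ((numR n).comp (X + C 1)).natDegree = (numR n).natDegree := by
      rw [natDegree_comp, natDegree_X_add_C, mul_one]
    have := natDegree_numR_le n
    exact degree_le_natDegree.trans_lt (by rw [hnat]; exact_mod_cast (by omega))
  exact exists_pf_data n 6 (by norm_num) _ hQ

/-- Existence of partial-fraction data for `r̃ₙ`. [cite: Zudilin2002Zeta5, Sect. 2 (construction of (7))] -/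
theorem exists_isDataRt (n : ℕ) : ∃ c, IsDataRt n c := by
  have hQ : ((numRt n).comp (X + C 1)).degree < ((6 * (n + 1) : ℕ) : WithBot ℕ) := by
    have hnat : ((numRt n).comp (X + C 1)).natDegree = (numRt n).natDegree := by
      rw [natDegree_comp, natDegree_X_add_C, mul_one]
    have := natDegree_numRt_le n
    exact degree_le_natDegree.trans_lt (by rw [hnat]; exact_mod_cast (by omega))
  exact exists_pf_data n 6 (by norm_num) _ hQ

/-- THE partial-fraction data of the summand of `rₙ` (a choice; any data give the same coefficient sums,
`uC_eq` etc.). [cite: Zudilin2002Zeta5, Sect. 2 (construction of (7))] -/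
def dataR (n : ℕ) : ℕ → ℕ → ℚ := Classical.choose (exists_isDataR n)

/-- THE partial-fraction data of the summand of `r̃ₙ`. [cite: Zudilin2002Zeta5, Sect. 2 (construction of (7))] -/
def dataRt (n : ℕ) : ℕ → ℕ → ℚ := Classical.choose (exists_isDataRt n)

/-- The chosen data are data. [cite: Zudilin2002Zeta5, Sect. 2 (construction of (7))] -/
theorem isDataR_dataR (n : ℕ) : IsDataR n (dataR n) := Classical.choose_spec (exists_isDataR n)

/-- The chosen data are data. [cite: Zudilin2002Zeta5, Sect. 2 (construction of (7))] -/
theorem isDataRt_dataRt (n : ℕ) : IsDataRt n (dataRt n) := Classical.choose_spec (exists_isDataRt n)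

/-- Uniqueness of partial-fraction data for `rₙ` on the support. [cite: Zudilin2002Zeta5, Sect. 2 (construction of (7))] -/
theorem IsDataR.eq {n : ℕ} {c c' : ℕ → ℕ → ℚ} (hc : IsDataR n c) (hc' : IsDataR n c') {o p : ℕ}
    (ho : o < 6) (hp : p ≤ n) : c o p = c' o p := by
  have h := pf_unique n 6 (fun o p => c o p - c' o p) 0 (fun t _ => by
    have hpole : ∀ p, p ≤ n → (t : ℚ) + p + 1 ≠ 0 := fun p _ => by positivity
    rw [pfEval_sub', hc _ hpole, hc' _ hpole, sub_self]) o p ho hp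
  exact sub_eq_zero.1 h

/-- Uniqueness of partial-fraction data for `r̃ₙ` on the support. [cite: Zudilin2002Zeta5, Sect. 2 (construction of (7))] -/
theorem IsDataRt.eq {n : ℕ} {c c' : ℕ → ℕ → ℚ} (hc : IsDataRt n c) (hc' : IsDataRt n c') {o p : ℕ}
    (ho : o < 6) (hp : p ≤ n) : c o p = c' o p := by
  have h := pf_unique n 6 (fun o p => c o p - c' o p) 0 (fun t _ => by
    have hpole : ∀ p, p ≤ n → (t : ℚ) + p + 1 ≠ 0 := fun p _ => by positivity
    rw [pfEval_sub', hc _ hpole, hc' _ hpole, sub_self]) o p ho hp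
  exact sub_eq_zero.1 h

/-- `uₙ`, the coefficient of `ζ(5)` in `rₙ`: the sum of the order-5 partial-fraction coefficients.
[cite: Zudilin2002Zeta5, Sect. 2 (display after (7))] -/
def uC (n : ℕ) : ℚ := ∑ p ∈ range (n + 1), dataR n 4 p

/-- `wₙ`, the coefficient of `ζ(3)` in `rₙ`. [cite: Zudilin2002Zeta5, Sect. 2 (display after (7))] -/
def wC (n : ℕ) : ℚ := ∑ p ∈ range (n + 1), dataR n 2 p

/-- `vₙ`, minus the constant term of `rₙ`: `Σ_{o<6} Σ_{p≤n} c_{o,p} H_p^{(o+1)}`. [cite: Zudilin2002Zeta5, Sect. 2 (display after (7))] -/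
def vC (n : ℕ) : ℚ := ∑ o ∈ range 6, ∑ p ∈ range (n + 1), dataR n o p * harm (o + 1) p

/-- `ũₙ`, the coefficient of `ζ(5)` in `r̃ₙ`. [cite: Zudilin2002Zeta5, Sect. 2 (display after (7))] -/
def utC (n : ℕ) : ℚ := ∑ p ∈ range (n + 1), dataRt n 4 p

/-- `w̃ₙ`, the coefficient of `ζ(3)` in `r̃ₙ`. [cite: Zudilin2002Zeta5, Sect. 2 (display after (7))] -/
def wtC (n : ℕ) : ℚ := ∑ p ∈ range (n + 1), dataRt n 2 p

/-- `ṽₙ`, minus the constant term of `r̃ₙ`. [cite: Zudilin2002Zeta5, Sect. 2 (display after (7))] -/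
def vtC (n : ℕ) : ℚ := ∑ o ∈ range 6, ∑ p ∈ range (n + 1), dataRt n o p * harm (o + 1) p

/-- `uₙ` from ANY data. [cite: Zudilin2002Zeta5, Sect. 2 (display after (7))] -/
theorem uC_eq {n : ℕ} {c : ℕ → ℕ → ℚ} (hc : IsDataR n c) : uC n = ∑ p ∈ range (n + 1), c 4 p :=
  sum_congr rfl fun p hp => (isDataR_dataR n).eq hc (by norm_num) (Nat.lt_succ_iff.1 (mem_range.1 hp))

/-- `wₙ` from ANY data. [cite: Zudilin2002Zeta5, Sect. 2 (display after (7))] -/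
theorem wC_eq {n : ℕ} {c : ℕ → ℕ → ℚ} (hc : IsDataR n c) : wC n = ∑ p ∈ range (n + 1), c 2 p :=
  sum_congr rfl fun p hp => (isDataR_dataR n).eq hc (by norm_num) (Nat.lt_succ_iff.1 (mem_range.1 hp))

/-- `vₙ` from ANY data. [cite: Zudilin2002Zeta5, Sect. 2 (display after (7))] -/
theorem vC_eq {n : ℕ} {c : ℕ → ℕ → ℚ} (hc : IsDataR n c) :
    vC n = ∑ o ∈ range 6, ∑ p ∈ range (n + 1), c o p * harm (o + 1) p :=
  sum_congr rfl fun o ho => sum_congr rfl fun p hp => by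
    rw [(isDataR_dataR n).eq hc (mem_range.1 ho) (Nat.lt_succ_iff.1 (mem_range.1 hp))]

/-- `ũₙ` from ANY data. [cite: Zudilin2002Zeta5, Sect. 2 (display after (7))] -/
theorem utC_eq {n : ℕ} {c : ℕ → ℕ → ℚ} (hc : IsDataRt n c) : utC n = ∑ p ∈ range (n + 1), c 4 p :=
  sum_congr rfl fun p hp => (isDataRt_dataRt n).eq hc (by norm_num) (Nat.lt_succ_iff.1 (mem_range.1 hp))

/-- `w̃ₙ` from ANY data. [cite: Zudilin2002Zeta5, Sect. 2 (display after (7))] -/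
theorem wtC_eq {n : ℕ} {c : ℕ → ℕ → ℚ} (hc : IsDataRt n c) : wtC n = ∑ p ∈ range (n + 1), c 2 p :=
  sum_congr rfl fun p hp => (isDataRt_dataRt n).eq hc (by norm_num) (Nat.lt_succ_iff.1 (mem_range.1 hp))

/-- `ṽₙ` from ANY data. [cite: Zudilin2002Zeta5, Sect. 2 (display after (7))] -/
theorem vtC_eq {n : ℕ} {c : ℕ → ℕ → ℚ} (hc : IsDataRt n c) :
    vtC n = ∑ o ∈ range 6, ∑ p ∈ range (n + 1), c o p * harm (o + 1) p :=
  sum_congr rfl fun o ho => sum_congr rfl fun p hp => by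
    rw [(isDataRt_dataRt n).eq hc (mem_range.1 ho) (Nat.lt_succ_iff.1 (mem_range.1 hp))]

/-! ### The forms (7) and their decomposition -/

/-- The `k`-th term (`k ≥ 0` standing for the printed `k+1 ≥ 1`) of the series `rₙ` of (7):
`numR n (k+1) / ((k+1)_{n+1})⁶`. [cite: Zudilin2002Zeta5, Sect. 2, eq. (7)] -/
def rTerm (n k : ℕ) : ℝ :=
  aeval ((k : ℝ) + 1) (numR n) / CressonFischlerRivoal2008.poch (k + 1) n ^ 6

/-- The `k`-th term of the series `r̃ₙ` of (7). [cite: Zudilin2002Zeta5, Sect. 2, eq. (7)] -/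
def rtTerm (n k : ℕ) : ℝ :=
  aeval ((k : ℝ) + 1) (numRt n) / CressonFischlerRivoal2008.poch (k + 1) n ^ 6

/-- `rₙ` of (7) (a real number; the series converges absolutely, `hasSum_rTerm`).
[cite: Zudilin2002Zeta5, Sect. 2, eq. (7)] -/
def rForm (n : ℕ) : ℝ := ∑' k : ℕ, rTerm n k

/-- `r̃ₙ` of (7). [cite: Zudilin2002Zeta5, Sect. 2, eq. (7)] -/
def rtForm (n : ℕ) : ℝ := ∑' k : ℕ, rtTerm n k

/-- The odd integers in `[3, 6]` are `3` and `5`. [folklore] -/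
private theorem filter_odd_Icc_three_six : (Icc 3 6).filter Odd = ({3, 5} : Finset ℕ) := by decide

/-- **`rₙ = uₙζ(5) + wₙζ(3) − vₙ`** with the coefficients read off ANY partial-fraction data (Cresson–Fischler–Rivoal,
Théorème 1 with explicit coefficients; the `ζ(2), ζ(4), ζ(6)` coefficients vanish by `numR_reflect`).
[cite: Zudilin2002Zeta5, Sect. 2 (display after (7): "are ℚ-linear forms in 1, ζ(3), ζ(5)")] -/
theorem hasSum_rTerm_of_data (n : ℕ) {c : ℕ → ℕ → ℚ} (hc : IsDataR n c) :
    HasSum (rTerm n)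
      ((∑ p ∈ range (n + 1), (c 4 p : ℝ)) * zetaValue 5 + (∑ p ∈ range (n + 1), (c 2 p : ℝ)) * zetaValue 3 -
        ∑ o ∈ range 6, ∑ p ∈ range (n + 1), (c o p : ℝ) * (harm (o + 1) p : ℝ)) := by
  have hS := hasSum_of_pf_data n 6 (numR n) (by norm_num) (natDegree_numR_add_two_le n) (numR_reflect n) c hc
  unfold rTerm
  convert hS using 1
  rw [filter_odd_Icc_three_six, sum_pair (by norm_num)]
  simp only [Nat.reduceSub]
  ring

/-- **`r̃ₙ = ũₙζ(5) + w̃ₙζ(3) − ṽₙ`** with the coefficients read off ANY partial-fraction data.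
[cite: Zudilin2002Zeta5, Sect. 2 (display after (7))] -/
theorem hasSum_rtTerm_of_data (n : ℕ) {c : ℕ → ℕ → ℚ} (hc : IsDataRt n c) :
    HasSum (rtTerm n)
      ((∑ p ∈ range (n + 1), (c 4 p : ℝ)) * zetaValue 5 + (∑ p ∈ range (n + 1), (c 2 p : ℝ)) * zetaValue 3 -
        ∑ o ∈ range 6, ∑ p ∈ range (n + 1), (c o p : ℝ) * (harm (o + 1) p : ℝ)) := by
  have hS := hasSum_of_pf_data n 6 (numRt n) (by norm_num) (natDegree_numRt_add_two_le n) (numRt_reflect n)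
    c hc
  unfold rtTerm
  convert hS using 1
  rw [filter_odd_Icc_three_six, sum_pair (by norm_num)]
  simp only [Nat.reduceSub]
  ring

/-- **`rₙ = uₙζ(5) + wₙζ(3) − vₙ`** (as a convergent series). [cite: Zudilin2002Zeta5, Sect. 2 (display after (7))] -/
theorem hasSum_rTerm (n : ℕ) :
    HasSum (rTerm n) ((uC n : ℝ) * zetaValue 5 + (wC n : ℝ) * zetaValue 3 - (vC n : ℝ)) := by
  have h := hasSum_rTerm_of_data n (isDataR_dataR n)
  rw [uC, wC, vC]
  push_cast
  exact h

/-- **`r̃ₙ = ũₙζ(5) + w̃ₙζ(3) − ṽₙ`** (as a convergent series). [cite: Zudilin2002Zeta5, Sect. 2 (display after (7))] -/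
theorem hasSum_rtTerm (n : ℕ) :
    HasSum (rtTerm n) ((utC n : ℝ) * zetaValue 5 + (wtC n : ℝ) * zetaValue 3 - (vtC n : ℝ)) := by
  have h := hasSum_rtTerm_of_data n (isDataRt_dataRt n)
  rw [utC, wtC, vtC]
  push_cast
  exact h

/-- **`rₙ = uₙζ(5) + wₙζ(3) − vₙ`**. [cite: Zudilin2002Zeta5, Sect. 2 (display after (7))] -/
theorem rForm_eq (n : ℕ) : rForm n = (uC n : ℝ) * zetaValue 5 + (wC n : ℝ) * zetaValue 3 - (vC n : ℝ) :=
  (hasSum_rTerm n).tsum_eq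

/-- **`r̃ₙ = ũₙζ(5) + w̃ₙζ(3) − ṽₙ`**. [cite: Zudilin2002Zeta5, Sect. 2 (display after (7))] -/
theorem rtForm_eq (n : ℕ) :
    rtForm n = (utC n : ℝ) * zetaValue 5 + (wtC n : ℝ) * zetaValue 3 - (vtC n : ℝ) :=
  (hasSum_rtTerm n).tsum_eq

/-! ### The summands through Rivoal's rational function `R_n = BallRivoal.R 6 1 n`

In the shifted variable `t = k − 1` the summand of `rₙ` is `(t + 1 + n/2) · R_n(t)` with
`R_n(t) = n!⁴ (t−n+1)_n (t+n+2)_n/(t+1)_{n+1}⁶` the Ball–Rivoal/Rivoal rational function with `a = 6`, `r = 1`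
(`BallRivoal.R`), and the summand of `r̃ₙ` is `−(t+1)(t+1+n)(t+1+n/2) · R_n(t)`. -/

/-- `BallRivoal.R 6 1 n` unfolded. [cite: Zudilin2002Zeta5, Sect. 2, eq. (7)] -/
theorem R_six_one_eq (n : ℕ) (t : ℚ) :
    R 6 1 n t = (n.factorial : ℚ) ^ 4 * poch (t - n + 1) n * poch (t + n + 2) n / poch (t + 1) (n + 1) ^ 6 := by
  simp [R]

/-- The summand of `rₙ` in the shifted variable: `numR n (t+1)/(t+1)_{n+1}⁶ = (t + 1 + n/2)·R_n(t)`.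
[cite: Zudilin2002Zeta5, Sect. 2, eq. (7)] -/
theorem quot_numR_eq (n : ℕ) (t : ℚ) :
    ((numR n).comp (X + C 1)).eval t / poch (t + 1) (n + 1) ^ 6 = (t + 1 + n / 2) * R 6 1 n t := by
  rw [eval_comp, eval_add, eval_X, eval_C, eval_numR, R_six_one_eq,
    show t + 1 - (n : ℚ) = t - n + 1 by ring, show t + 1 + (n : ℚ) + 1 = t + n + 2 by ring]
  ring

/-- The summand of `r̃ₙ` in the shifted variable: `numRt n (t+1)/(t+1)_{n+1}⁶ = −(t+1)(t+1+n)(t+1+n/2)·R_n(t)`.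
[cite: Zudilin2002Zeta5, Sect. 2, eq. (7)] -/
theorem quot_numRt_eq (n : ℕ) (t : ℚ) :
    ((numRt n).comp (X + C 1)).eval t / poch (t + 1) (n + 1) ^ 6 =
      -((t + 1) * (t + 1 + n)) * ((t + 1 + n / 2) * R 6 1 n t) := by
  rw [← quot_numR_eq, eval_comp, eval_add, eval_X, eval_C, eval_numRt, eval_comp, eval_add, eval_X, eval_C]
  ring

/-- Partial-fraction data of `rₙ` evaluate to `(t + 1 + n/2)·R_n(t)`. [cite: Zudilin2002Zeta5, Sect. 2, eq. (7)] -/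
theorem IsDataR.pfEval_eq {n : ℕ} {c : ℕ → ℕ → ℚ} (hc : IsDataR n c) (t : ℚ)
    (ht : ∀ p, p ≤ n → t + p + 1 ≠ 0) : pfEval n 6 c t = (t + 1 + n / 2) * R 6 1 n t := by
  rw [hc t ht, quot_numR_eq]

/-- Partial-fraction data of `r̃ₙ` evaluate to `−(t+1)(t+1+n)(t+1+n/2)·R_n(t)`. [cite: Zudilin2002Zeta5, Sect. 2, eq. (7)] -/
theorem IsDataRt.pfEval_eq {n : ℕ} {c : ℕ → ℕ → ℚ} (hc : IsDataRt n c) (t : ℚ)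
    (ht : ∀ p, p ≤ n → t + p + 1 ≠ 0) :
    pfEval n 6 c t = -((t + 1) * (t + 1 + n)) * ((t + 1 + n / 2) * R 6 1 n t) := by
  rw [hc t ht, quot_numRt_eq]

/-- A polynomial over `ℚ` evaluated at the real number `k + 1` is its shift evaluated at `k` over `ℚ`. [folklore] -/
private theorem aeval_succ_eq (P : ℚ[X]) (k : ℕ) :
    aeval ((k : ℝ) + 1) P = (((P.comp (X + C 1)).eval (k : ℚ) : ℚ) : ℝ) := by
  rw [eval_comp, eval_add, eval_X, eval_C, ← eq_ratCast (algebraMap ℚ ℝ),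
    ← aeval_algebraMap_apply_eq_algebraMap_eval, map_add, map_natCast, map_one]

/-- The real Pochhammer symbol of Cresson–Fischler–Rivoal is the rational one of Ball–Rivoal. [folklore] -/
private theorem cfrPoch_eq (k n : ℕ) :
    CressonFischlerRivoal2008.poch (k + 1) n = ((poch ((k : ℚ) + 1) (n + 1) : ℚ) : ℝ) := by
  rw [CressonFischlerRivoal2008.poch, poch]
  push_cast
  rfl

/-- **The terms of `rₙ`**: `rTerm n k = (k + 1 + n/2)·R_n(k)`. [cite: Zudilin2002Zeta5, Sect. 2, eq. (7)] -/
theorem rTerm_eq (n k : ℕ) : rTerm n k = ((((k : ℚ) + 1 + n / 2) * R 6 1 n k : ℚ) : ℝ) := by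
  rw [rTerm, aeval_succ_eq, cfrPoch_eq, ← quot_numR_eq]
  push_cast
  ring

/-- **The terms of `r̃ₙ`**: `rtTerm n k = −(k+1)(k+1+n)(k+1+n/2)·R_n(k)`. [cite: Zudilin2002Zeta5, Sect. 2, eq. (7)] -/
theorem rtTerm_eq (n k : ℕ) :
    rtTerm n k = ((-(((k : ℚ) + 1) * ((k : ℚ) + 1 + n)) * (((k : ℚ) + 1 + n / 2) * R 6 1 n k) : ℚ) : ℝ) := by
  rw [rtTerm, aeval_succ_eq, cfrPoch_eq, ← quot_numRt_eq]
  push_cast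
  ring

/-! ### Signs: `rₙ > 0`, `r̃ₙ < 0` (the `r`-parts of (10) and (12)) -/

/-- `R_n(k) = 0` for naturals `k < n` and `R_n(k) > 0` for naturals `k ≥ n`. [cite: Zudilin2002Zeta5, Sect. 2, eq. (7)] -/
theorem R_natCast_pos {n k : ℕ} (hk : n ≤ k) : 0 < R 6 1 n k := by
  rw [R_six_one_eq]
  have h1 : (0 : ℚ) < (k : ℚ) - n + 1 := by
    have : ((n : ℕ) : ℚ) ≤ k := by exact_mod_cast hk
    linarith
  have h2 : (0 : ℚ) < (k : ℚ) + n + 2 := by positivity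
  have h3 : (0 : ℚ) < (k : ℚ) + 1 := by positivity
  exact div_pos (mul_pos (mul_pos (by positivity) (poch_pos h1 n)) (poch_pos h2 n)) (pow_pos (poch_pos h3 _) 6)

/-- The terms of `rₙ` are nonnegative. [cite: Zudilin2002Zeta5, Sect. 2, (10)] -/
theorem rTerm_nonneg (n k : ℕ) : 0 ≤ rTerm n k := by
  rw [rTerm_eq]
  have h := R_natCast_nonneg 6 1 n k
  exact_mod_cast mul_nonneg (by positivity) h

/-- The term `k = n` of `rₙ` is positive. [cite: Zudilin2002Zeta5, Sect. 2, (10)] -/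
theorem rTerm_pos (n : ℕ) : 0 < rTerm n n := by
  rw [rTerm_eq]
  have h := R_natCast_pos (le_refl n)
  exact_mod_cast mul_pos (by positivity) h

/-- The terms of `r̃ₙ` are nonpositive. [cite: Zudilin2002Zeta5, Sect. 2, (12)] -/
theorem rtTerm_nonpos (n k : ℕ) : rtTerm n k ≤ 0 := by
  rw [rtTerm_eq]
  have h := R_natCast_nonneg 6 1 n k
  have h' : (0 : ℚ) ≤ ((k : ℚ) + 1) * ((k : ℚ) + 1 + n) * (((k : ℚ) + 1 + n / 2) * R 6 1 n k) := by positivity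
  have : (-(((k : ℚ) + 1) * ((k : ℚ) + 1 + n)) * (((k : ℚ) + 1 + n / 2) * R 6 1 n k) : ℚ) ≤ 0 := by linarith
  exact_mod_cast this

/-- The term `k = n` of `r̃ₙ` is negative. [cite: Zudilin2002Zeta5, Sect. 2, (12)] -/
theorem rtTerm_neg (n : ℕ) : rtTerm n n < 0 := by
  rw [rtTerm_eq]
  have h := R_natCast_pos (le_refl n)
  have h' : (0 : ℚ) < ((n : ℚ) + 1) * ((n : ℚ) + 1 + n) * (((n : ℚ) + 1 + n / 2) * R 6 1 n n) := by positivity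
  have : (-(((n : ℚ) + 1) * ((n : ℚ) + 1 + n)) * (((n : ℚ) + 1 + n / 2) * R 6 1 n n) : ℚ) < 0 := by linarith
  exact_mod_cast this

/-- **`rₙ > 0`** (the first inequality of (10); all terms of (7) are `≥ 0`, the term `k = n+1` is `> 0`).
[cite: Zudilin2002Zeta5, Theorem 2, (10)] -/
theorem rForm_pos (n : ℕ) : 0 < rForm n :=
  (hasSum_rTerm n).summable.tsum_pos (rTerm_nonneg n) n (rTerm_pos n)

/-- **`r̃ₙ < 0`** (the first inequality of (12)). [cite: Zudilin2002Zeta5, Theorem 3, (12)] -/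
theorem rtForm_neg (n : ℕ) : rtForm n < 0 := by
  have h : 0 < ∑' k : ℕ, -rtTerm n k :=
    (hasSum_rtTerm n).summable.neg.tsum_pos (fun k => neg_nonneg.2 (rtTerm_nonpos n k)) n
      (neg_pos.2 (rtTerm_neg n))
  rw [tsum_neg] at h
  exact neg_pos.1 h

/-! ### A crude decay estimate: `R_n(k) ≤ (n+1)⁴/(128ⁿ (k+1)⁶)` on `ℕ` -/

/-- `(k−n+1)_n ≤ (k+2)_n` for naturals `k ≥ n` (termwise). [folklore] -/
private theorem poch_low_le (n k : ℕ) (hk : n ≤ k) : poch ((k : ℚ) - n + 1) n ≤ poch ((k : ℚ) + 2) n := by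
  have hk' : ((n : ℕ) : ℚ) ≤ k := by exact_mod_cast hk
  unfold poch
  refine prod_le_prod (fun s _ => by linarith [(s.cast_nonneg : (0 : ℚ) ≤ s)]) fun s _ => by linarith

/-- `(k+n+2)_n ≤ 2ⁿ (k+2)_n` for naturals `k ≥ n` (termwise: `k+n+2+s ≤ 2(k+2+s)`). [folklore] -/
private theorem poch_high_le (n k : ℕ) (hk : n ≤ k) :
    poch ((k : ℚ) + n + 2) n ≤ 2 ^ n * poch ((k : ℚ) + 2) n := by
  have hk' : ((n : ℕ) : ℚ) ≤ k := by exact_mod_cast hk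
  unfold poch
  rw [show (2 : ℚ) ^ n = ∏ _s ∈ range n, (2 : ℚ) by rw [prod_const, card_range], ← prod_mul_distrib]
  refine prod_le_prod (fun s _ => by positivity) fun s _ => ?_
  linarith [(s.cast_nonneg : (0 : ℚ) ≤ s)]

/-- `(k+1)_{n+1} = (k+1)·(k+2)_n`. [folklore] -/
private theorem poch_split (n : ℕ) (x : ℚ) : poch x (n + 1) = x * poch (x + 1) n := by
  unfold poch
  rw [prod_range_succ', mul_comm]
  simp only [Nat.cast_zero, add_zero, Nat.cast_add, Nat.cast_one]
  congr 1
  exact prod_congr rfl fun s _ => by ring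

/-- `(n+1)·(k+1)_{n+1} ≥ (k+1)·(n+1)_{n+1}` for naturals `k ≥ n`. [folklore] -/
private theorem poch_diag_le (n k : ℕ) (hk : n ≤ k) :
    ((k : ℚ) + 1) * poch ((n : ℚ) + 1) (n + 1) ≤ ((n : ℚ) + 1) * poch ((k : ℚ) + 1) (n + 1) := by
  have hk' : ((n : ℕ) : ℚ) ≤ k := by exact_mod_cast hk
  rw [poch_split, poch_split, ← mul_assoc, ← mul_assoc, mul_comm ((k : ℚ) + 1) ((n : ℚ) + 1)]
  refine mul_le_mul_of_nonneg_left ?_ (by positivity)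
  unfold poch
  exact prod_le_prod (fun s _ => by positivity) fun s _ => by linarith

/-- `(n+1)_{n+1} = (2n+1)·C(2n,n)·n!`. [folklore] -/
private theorem poch_diag_eq (n : ℕ) :
    poch ((n : ℚ) + 1) (n + 1) = (2 * n + 1) * (Nat.centralBinom n : ℚ) * n.factorial := by
  rw [poch_natCast_succ, show n + (n + 1) = 2 * n + 1 by ring, Nat.factorial_succ]
  have h : (n + 1) * (2 * n + 1).choose (n + 1) = (2 * n + 1) * Nat.centralBinom n := by
    rw [Nat.centralBinom_eq_two_mul_choose, mul_comm (n + 1), ← Nat.add_one_mul_choose_eq]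
  have h' : ((n : ℚ) + 1) * ((2 * n + 1).choose (n + 1) : ℚ) = (2 * n + 1) * (Nat.centralBinom n : ℚ) := by
    exact_mod_cast h
  push_cast
  linear_combination (n.factorial : ℚ) * h'

/-- `4ⁿ ≤ (2n+1)·C(2n,n)` over `ℚ`. [folklore] -/
private theorem four_pow_le_diag (n : ℕ) : (4 : ℚ) ^ n ≤ (2 * n + 1) * (Nat.centralBinom n : ℚ) := by
  exact_mod_cast Nat.four_pow_le_two_mul_add_one_mul_central_binom n

/-- **Decay of `R_n` on `ℕ`**: `R_n(k) ≤ (n+1)⁴/(128ⁿ (k+1)⁶)` for every natural `k` (zero for `k < n`).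
A crude form of the estimates behind (11); enough for the limits below. [cite: Zudilin2002Zeta5, Sect. 2, eq. (7) and (11)] -/
theorem R_natCast_le_decay (n k : ℕ) :
    R 6 1 n k ≤ ((n : ℚ) + 1) ^ 4 / (128 ^ n * ((k : ℚ) + 1) ^ 6) := by
  rcases lt_or_ge k n with hk | hk
  · rw [R_natCast_eq_zero 6 1 n k (by omega)]
    positivity
  set P := poch ((k : ℚ) + 1) (n + 1) with hP
  set D := poch ((n : ℚ) + 1) (n + 1) with hD
  have hPpos : 0 < P := poch_pos (by positivity) _
  have hk1 : (0 : ℚ) < (k : ℚ) + 1 := by positivity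
  have hQpos : 0 < poch ((k : ℚ) + 2) n := poch_pos (by positivity) _
  -- the numerator Pochhammers against `(k+2)_n`, and `P = (k+1)·(k+2)_n`
  have hsplit : P = ((k : ℚ) + 1) * poch ((k : ℚ) + 2) n := by
    rw [hP, poch_split, show (k : ℚ) + 1 + 1 = k + 2 by ring]
  have h1 := poch_low_le n k hk
  have h2 := poch_high_le n k hk
  have h2' : 0 ≤ poch ((k : ℚ) + n + 2) n := (poch_pos (by positivity) _).le
  have hnum : (n.factorial : ℚ) ^ 4 * poch ((k : ℚ) - n + 1) n * poch ((k : ℚ) + n + 2) n ≤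
      (n.factorial : ℚ) ^ 4 * poch ((k : ℚ) + 2) n * (2 ^ n * poch ((k : ℚ) + 2) n) :=
    mul_le_mul (mul_le_mul_of_nonneg_left h1 (by positivity)) h2 h2'
      (mul_nonneg (by positivity) hQpos.le)
  -- `D = (2n+1) C(2n,n) n! ≥ 4ⁿ n!` and `(n+1) P ≥ (k+1) D`
  have hDeq : D = (2 * n + 1) * (Nat.centralBinom n : ℚ) * n.factorial := poch_diag_eq n
  have hDge : (4 : ℚ) ^ n * n.factorial ≤ D := by
    rw [hDeq]
    exact mul_le_mul_of_nonneg_right (four_pow_le_diag n) (by positivity)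
  have hPD : ((k : ℚ) + 1) * D ≤ ((n : ℚ) + 1) * P := poch_diag_le n k hk
  have hkey : ((k : ℚ) + 1) * (4 ^ n * n.factorial) ≤ ((n : ℚ) + 1) * P :=
    (mul_le_mul_of_nonneg_left hDge hk1.le).trans hPD
  have hkey4 : (((k : ℚ) + 1) * (4 ^ n * n.factorial)) ^ 4 ≤ (((n : ℚ) + 1) * P) ^ 4 :=
    pow_le_pow_left₀ (by positivity) hkey 4
  have h256 : (2 : ℚ) ^ n * 128 ^ n = (4 ^ n) ^ 4 := by
    rw [← mul_pow, ← pow_mul, mul_comm n 4, pow_mul]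
    norm_num
  have e : (((k : ℚ) + 1) * (4 ^ n * n.factorial)) ^ 4 = ((k : ℚ) + 1) ^ 4 * (2 ^ n * 128 ^ n) * n.factorial ^ 4 := by
    rw [h256]
    ring
  -- assemble
  rw [R_six_one_eq, div_le_div_iff₀ (pow_pos hPpos 6) (by positivity)]
  calc (n.factorial : ℚ) ^ 4 * poch ((k : ℚ) - n + 1) n * poch ((k : ℚ) + n + 2) n *
        (128 ^ n * ((k : ℚ) + 1) ^ 6)
      ≤ (n.factorial : ℚ) ^ 4 * poch ((k : ℚ) + 2) n * (2 ^ n * poch ((k : ℚ) + 2) n) *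
          (128 ^ n * ((k : ℚ) + 1) ^ 6) := mul_le_mul_of_nonneg_right hnum (by positivity)
    _ = (((k : ℚ) + 1) * (4 ^ n * n.factorial)) ^ 4 * (((k : ℚ) + 1) * poch ((k : ℚ) + 2) n) ^ 2 := by
        rw [e]
        ring
    _ = (((k : ℚ) + 1) * (4 ^ n * n.factorial)) ^ 4 * P ^ 2 := by rw [← hsplit]
    _ ≤ (((n : ℚ) + 1) * P) ^ 4 * P ^ 2 := mul_le_mul_of_nonneg_right hkey4 (by positivity)
    _ = ((n : ℚ) + 1) ^ 4 * P ^ 6 := by ring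

/-- Termwise bound for `rₙ`: `(k+1+n/2)·R_n(k) ≤ (3/2)(n+1)⁴/128ⁿ · 1/(k+1)²`. [cite: Zudilin2002Zeta5, Sect. 2, (7) and (11)] -/
theorem rTerm_le_rat (n k : ℕ) :
    ((k : ℚ) + 1 + n / 2) * R 6 1 n k ≤ 3 / 2 * ((n : ℚ) + 1) ^ 4 / 128 ^ n * (1 / ((k : ℚ) + 0 + 1) ^ 2) := by
  rcases lt_or_ge k n with hk | hk
  · rw [R_natCast_eq_zero 6 1 n k (by omega), mul_zero]
    positivity
  have hk' : ((n : ℕ) : ℚ) ≤ k := by exact_mod_cast hk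
  have hk1 : (1 : ℚ) ≤ (k : ℚ) + 1 := by linarith [(k.cast_nonneg : (0 : ℚ) ≤ k)]
  have hR := R_natCast_le_decay n k
  have hR0 := R_natCast_nonneg 6 1 n k
  have hfac : (k : ℚ) + 1 + n / 2 ≤ 3 / 2 * ((k : ℚ) + 1) := by linarith
  have hpow : ((k : ℚ) + 1) ^ 2 * ((k : ℚ) + 1) ≤ ((k : ℚ) + 1) ^ 6 := by
    calc ((k : ℚ) + 1) ^ 2 * ((k : ℚ) + 1) = ((k : ℚ) + 1) ^ 3 * 1 := by ring
      _ ≤ ((k : ℚ) + 1) ^ 3 * ((k : ℚ) + 1) ^ 3 :=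
          mul_le_mul_of_nonneg_left (one_le_pow₀ hk1) (by positivity)
      _ = ((k : ℚ) + 1) ^ 6 := by ring
  calc ((k : ℚ) + 1 + n / 2) * R 6 1 n k
      ≤ 3 / 2 * ((k : ℚ) + 1) * (((n : ℚ) + 1) ^ 4 / (128 ^ n * ((k : ℚ) + 1) ^ 6)) :=
        mul_le_mul hfac hR hR0 (by positivity)
    _ ≤ 3 / 2 * ((k : ℚ) + 1) * (((n : ℚ) + 1) ^ 4 / (128 ^ n * (((k : ℚ) + 1) ^ 2 * ((k : ℚ) + 1)))) := by
        gcongr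
    _ = 3 / 2 * ((n : ℚ) + 1) ^ 4 / 128 ^ n * (1 / ((k : ℚ) + 0 + 1) ^ 2) := by
        field_simp
        ring

/-- Termwise bound for `r̃ₙ`: `(k+1)(k+1+n)(k+1+n/2)·R_n(k) ≤ 3(n+1)⁴/128ⁿ · 1/(k+1)²`. [cite: Zudilin2002Zeta5, Sect. 2, (7) and (13)] -/
theorem rtTerm_le_rat (n k : ℕ) :
    ((k : ℚ) + 1) * ((k : ℚ) + 1 + n) * (((k : ℚ) + 1 + n / 2) * R 6 1 n k) ≤
      3 * ((n : ℚ) + 1) ^ 4 / 128 ^ n * (1 / ((k : ℚ) + 0 + 1) ^ 2) := by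
  rcases lt_or_ge k n with hk | hk
  · rw [R_natCast_eq_zero 6 1 n k (by omega), mul_zero, mul_zero]
    positivity
  have hk' : ((n : ℕ) : ℚ) ≤ k := by exact_mod_cast hk
  have hk1 : (1 : ℚ) ≤ (k : ℚ) + 1 := by linarith [(k.cast_nonneg : (0 : ℚ) ≤ k)]
  have hR := R_natCast_le_decay n k
  have hR0 := R_natCast_nonneg 6 1 n k
  have hfac : ((k : ℚ) + 1) * ((k : ℚ) + 1 + n) * ((k : ℚ) + 1 + n / 2) ≤ 3 * ((k : ℚ) + 1) ^ 3 := by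
    have h1 : (k : ℚ) + 1 + n ≤ 2 * ((k : ℚ) + 1) := by linarith
    have h2 : (k : ℚ) + 1 + n / 2 ≤ 3 / 2 * ((k : ℚ) + 1) := by linarith
    calc ((k : ℚ) + 1) * ((k : ℚ) + 1 + n) * ((k : ℚ) + 1 + n / 2)
        ≤ ((k : ℚ) + 1) * (2 * ((k : ℚ) + 1)) * (3 / 2 * ((k : ℚ) + 1)) := by gcongr
      _ = 3 * ((k : ℚ) + 1) ^ 3 := by ring
  have hpow : ((k : ℚ) + 1) ^ 2 * ((k : ℚ) + 1) ^ 3 ≤ ((k : ℚ) + 1) ^ 6 := by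
    calc ((k : ℚ) + 1) ^ 2 * ((k : ℚ) + 1) ^ 3 = ((k : ℚ) + 1) ^ 5 * 1 := by ring
      _ ≤ ((k : ℚ) + 1) ^ 5 * ((k : ℚ) + 1) := mul_le_mul_of_nonneg_left hk1 (by positivity)
      _ = ((k : ℚ) + 1) ^ 6 := by ring
  calc ((k : ℚ) + 1) * ((k : ℚ) + 1 + n) * (((k : ℚ) + 1 + n / 2) * R 6 1 n k)
      = (((k : ℚ) + 1) * ((k : ℚ) + 1 + n) * ((k : ℚ) + 1 + n / 2)) * R 6 1 n k := by ring
    _ ≤ 3 * ((k : ℚ) + 1) ^ 3 * (((n : ℚ) + 1) ^ 4 / (128 ^ n * ((k : ℚ) + 1) ^ 6)) :=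
        mul_le_mul hfac hR hR0 (by positivity)
    _ ≤ 3 * ((k : ℚ) + 1) ^ 3 * (((n : ℚ) + 1) ^ 4 / (128 ^ n * (((k : ℚ) + 1) ^ 2 * ((k : ℚ) + 1) ^ 3))) := by
        gcongr
    _ = 3 * ((n : ℚ) + 1) ^ 4 / 128 ^ n * (1 / ((k : ℚ) + 0 + 1) ^ 2) := by
        field_simp
        ring

/-- **`0 < rₙ ≤ (3/2)ζ(2)(n+1)⁴/128ⁿ`** (upper bound; crude version of the rate (11) `log rₙ/n → log λ₁`,
`λ₁ = 0.00169…`). [cite: Zudilin2002Zeta5, Theorem 2, (10)–(11)] -/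
theorem rForm_le (n : ℕ) : rForm n ≤ 3 / 2 * ((n : ℝ) + 1) ^ 4 / 128 ^ n * zetaValue 2 := by
  have hZ := hasSum_one_div_pow_shift 2 0 (le_refl 2)
  have h0 : (harm 2 0 : ℝ) = 0 := by simp [harm]
  rw [h0, sub_zero, Nat.cast_zero] at hZ
  have hle : ∀ k : ℕ, rTerm n k ≤ 3 / 2 * ((n : ℝ) + 1) ^ 4 / 128 ^ n * (1 / ((k : ℝ) + 0 + 1) ^ 2) := by
    intro k
    rw [rTerm_eq]
    have h := (Rat.cast_le (K := ℝ)).2 (rTerm_le_rat n k)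
    push_cast at h ⊢
    exact h
  have h := hasSum_le hle (hasSum_rTerm n) (hZ.mul_left (3 / 2 * ((n : ℝ) + 1) ^ 4 / 128 ^ n))
  rw [rForm_eq]
  exact h

/-- **`−3ζ(2)(n+1)⁴/128ⁿ ≤ r̃ₙ < 0`** (crude version of the rate (13)). [cite: Zudilin2002Zeta5, Theorem 3, (12)–(13)] -/
theorem neg_rtForm_le (n : ℕ) : -rtForm n ≤ 3 * ((n : ℝ) + 1) ^ 4 / 128 ^ n * zetaValue 2 := by
  have hZ := hasSum_one_div_pow_shift 2 0 (le_refl 2)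
  have h0 : (harm 2 0 : ℝ) = 0 := by simp [harm]
  rw [h0, sub_zero, Nat.cast_zero] at hZ
  have hle : ∀ k : ℕ, -rtTerm n k ≤ 3 * ((n : ℝ) + 1) ^ 4 / 128 ^ n * (1 / ((k : ℝ) + 0 + 1) ^ 2) := by
    intro k
    rw [rtTerm_eq]
    have h := (Rat.cast_le (K := ℝ)).2 (rtTerm_le_rat n k)
    push_cast at h ⊢
    linarith
  have h := hasSum_le hle (hasSum_rtTerm n).neg (hZ.mul_left (3 * ((n : ℝ) + 1) ^ 4 / 128 ^ n))
  rw [rtForm_eq]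
  exact h

/-! ### Multiplying partial-fraction data by a linear factor; the size of the coefficients

The coefficients are controlled through EXPLICIT data: the Ball–Rivoal brick expansion of `R_n`
(`BallRivoal.exists_pf_R 6 1 n`, `Σ|c| ≤ 6!·2^{6n}·C(2n,n)²`) multiplied by `t + 1 + n/2` (for `rₙ`) and further by
`(t+1)(t+1+n)` (for `r̃ₙ`); by uniqueness these data compute `uₙ, wₙ, ũₙ, w̃ₙ`. -/

/-- Data of `(t + 1 + s)·F` from data `c` of `F` (6 orders): `t + 1 + s = (t+p+1) + (s − p)` lowers the order by one
and adds `(s−p)` times the old coefficient. [folklore] -/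
private def linMul (s : ℚ) (c : ℕ → ℕ → ℚ) : ℕ → ℕ → ℚ :=
  fun o p => (if o < 5 then c (o + 1) p else 0) + (s - p) * c o p

/-- `pfEval (linMul s c) t = (t+1+s)·pfEval c t − Σ_p c_{0,p}` (the constant `Σ_p c_{0,p}` drops out of the
partial-fraction shape; it vanishes for functions that are `o(1)` at infinity). [folklore] -/
private theorem pfEval_linMul (n : ℕ) (s : ℚ) (c : ℕ → ℕ → ℚ) (t : ℚ) (ht : ∀ p, p ≤ n → t + p + 1 ≠ 0) :
    pfEval n 6 (linMul s c) t = (t + 1 + s) * pfEval n 6 c t - ∑ p ∈ range (n + 1), c 0 p := by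
  unfold pfEval
  rw [mul_sum, ← sum_sub_distrib]
  refine sum_congr rfl fun p hp => ?_
  have hx : t + p + 1 ≠ 0 := ht p (Nat.lt_succ_iff.1 (mem_range.1 hp))
  have e : ∀ o : ℕ, (t + 1 + s) * (c o p / (t + p + 1) ^ (o + 1)) =
      c o p / (t + p + 1) ^ o + (s - p) * c o p / (t + p + 1) ^ (o + 1) := by
    intro o
    rw [pow_succ]
    field_simp
    ring
  have h1 : ∑ o ∈ range 6, (if o < 5 then c (o + 1) p else 0) / (t + p + 1) ^ (o + 1) =
      ∑ o ∈ range 5, c (o + 1) p / (t + p + 1) ^ (o + 1) := by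
    rw [sum_range_succ, if_neg (by norm_num), zero_div, add_zero]
    exact sum_congr rfl fun o ho => by rw [if_pos (mem_range.1 ho)]
  have h2 : ∑ o ∈ range 6, c o p / (t + p + 1) ^ o =
      ∑ o ∈ range 5, c (o + 1) p / (t + p + 1) ^ (o + 1) + c 0 p := by
    rw [sum_range_succ']
    simp
  simp only [linMul, add_div]
  rw [sum_add_distrib, h1, mul_sum, sum_congr rfl fun o _ => e o, sum_add_distrib, h2]
  ring

/-- The `ℓ¹` size of `linMul s c`: `Σ|linMul s c| ≤ (1 + M)·Σ|c|` whenever `|s − p| ≤ M` on the support. [folklore] -/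
private theorem l1_linMul_le (n : ℕ) (s M : ℚ) (c : ℕ → ℕ → ℚ) (hM : ∀ p, p ≤ n → |s - p| ≤ M) :
    l1 n 6 (linMul s c) ≤ (1 + M) * l1 n 6 c := by
  unfold l1
  rw [mul_sum]
  refine sum_le_sum fun p hp => ?_
  have hMp := hM p (Nat.lt_succ_iff.1 (mem_range.1 hp))
  have h1 : ∑ o ∈ range 6, |(if o < 5 then c (o + 1) p else 0)| ≤ ∑ o ∈ range 6, |c o p| := by
    have e1 : ∑ o ∈ range 6, |(if o < 5 then c (o + 1) p else 0)| = ∑ o ∈ range 5, |c (o + 1) p| := by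
      rw [sum_range_succ, if_neg (by norm_num), abs_zero, add_zero]
      exact sum_congr rfl fun o ho => by rw [if_pos (mem_range.1 ho)]
    rw [e1, sum_range_succ' (fun o => |c o p|) 5]
    linarith [abs_nonneg (c 0 p)]
  calc ∑ o ∈ range 6, |linMul s c o p|
      ≤ ∑ o ∈ range 6, (|(if o < 5 then c (o + 1) p else 0)| + M * |c o p|) := sum_le_sum fun o _ => by
        unfold linMul
        refine (abs_add_le _ _).trans (add_le_add le_rfl ?_)
        rw [abs_mul]
        exact mul_le_mul_of_nonneg_right hMp (abs_nonneg _)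
    _ = ∑ o ∈ range 6, |(if o < 5 then c (o + 1) p else 0)| + M * ∑ o ∈ range 6, |c o p| := by
        rw [sum_add_distrib, mul_sum]
    _ ≤ ∑ o ∈ range 6, |c o p| + M * ∑ o ∈ range 6, |c o p| := by linarith [h1]
    _ = (1 + M) * ∑ o ∈ range 6, |c o p| := by ring

/-- A sign change does not change the `ℓ¹` size. [folklore] -/
private theorem l1_neg (n : ℕ) (c : ℕ → ℕ → ℚ) : l1 n 6 (fun o p => (-1 : ℚ) * c o p) = l1 n 6 c := by
  unfold l1
  exact sum_congr rfl fun p _ => sum_congr rfl fun o _ => by rw [abs_mul, abs_neg, abs_one, one_mul]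

/-- A coefficient sum of fixed order is bounded by the `ℓ¹` size of the data. [folklore] -/
private theorem abs_sum_le_l1 (n : ℕ) (c : ℕ → ℕ → ℚ) {o : ℕ} (ho : o < 6) :
    |∑ p ∈ range (n + 1), c o p| ≤ l1 n 6 c := by
  unfold l1
  refine (abs_sum_le_sum_abs _ _).trans (sum_le_sum fun p _ => ?_)
  exact single_le_sum (f := fun o => |c o p|) (fun o _ => abs_nonneg _) (mem_range.2 ho)

/-- **Explicit bounded data**: there are partial-fraction data `c` of `rₙ` and `c̃` of `r̃ₙ` with
`Σ|c| ≤ 720(n+1)·64ⁿC(2n,n)²` and `Σ|c̃| ≤ 720(n+1)³·64ⁿC(2n,n)²` (the brick expansion of `R_n` multiplied by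
the very-well-poised factor, resp. also by `k(k+n)`). [cite: Zudilin2002Zeta5, Sect. 2 (construction of (7))] -/
theorem exists_data_l1_le (n : ℕ) :
    ∃ c ct : ℕ → ℕ → ℚ, IsDataR n c ∧ IsDataRt n ct ∧
      l1 n 6 c ≤ 720 * ((n : ℚ) + 1) * (64 ^ n * (Nat.centralBinom n : ℚ) ^ 2) ∧
      l1 n 6 ct ≤ 720 * ((n : ℚ) + 1) ^ 3 * (64 ^ n * (Nat.centralBinom n : ℚ) ^ 2) := by
  obtain ⟨c0, hc0, -, hl0⟩ := exists_pf_R 6 1 n 0 (by norm_num) (by norm_num) (fun k _ _ => dvd_zero _)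
  set B : ℚ := 64 ^ n * (Nat.centralBinom n : ℚ) ^ 2 with hBdef
  have hB0 : 0 ≤ B := by positivity
  have hB : l1 n 6 c0 ≤ 720 * B := by
    have e : (2 : ℚ) ^ (6 * n) * ∏ L ∈ range 1, ((((n * (L + 2)).choose n : ℕ)) : ℚ) ^ 2 = B := by
      rw [hBdef, prod_range_one, pow_mul, Nat.centralBinom_eq_two_mul_choose,
        show n * (0 + 2) = 2 * n by ring]
      norm_num
    have e' : ((Nat.factorial 6 : ℕ) : ℚ) = 720 := by norm_num [Nat.factorial]
    calc l1 n 6 c0 ≤ _ := hl0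
      _ = 720 * B := by rw [e', e]
  have hl00 : 0 ≤ l1 n 6 c0 := sum_nonneg fun _ _ => sum_nonneg fun _ _ => abs_nonneg _
  have hz0 : ∑ p ∈ range (n + 1), c0 0 p = 0 := sum_c_zero_eq_zero 6 1 n (by norm_num) (by norm_num) c0 hc0
  -- `c1`: data of `(t + 1 + n/2) R_n`, i.e. of `rₙ`
  set c1 := linMul ((n : ℚ) / 2) c0 with hc1def
  have hc1 : IsDataR n c1 := by
    intro t ht
    rw [hc1def, pfEval_linMul n _ c0 t ht, hz0, sub_zero, hc0 t ht, quot_numR_eq]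
  have hl1 : l1 n 6 c1 ≤ (1 + n / 2) * l1 n 6 c0 := l1_linMul_le n _ _ c0 fun p hp => by
    have hp' : ((p : ℕ) : ℚ) ≤ n := by exact_mod_cast hp
    rw [abs_le]
    constructor <;> linarith [(p.cast_nonneg : (0 : ℚ) ≤ p)]
  -- `c2`: data of `(t+1)(t + 1 + n/2) R_n`
  have hdeg1 : ((numR n).comp (X + C 1)).natDegree + 2 ≤ 6 * (n + 1) := by
    rw [natDegree_comp, natDegree_X_add_C, mul_one]
    exact natDegree_numR_add_two_le n
  have hz1 : ∑ p ∈ range (n + 1), c1 0 p = 0 :=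
    partialFractions_sum_order_zero n 6 (by norm_num) _ hdeg1 c1 hc1
  set c2 := linMul 0 c1 with hc2def
  have hc2 : ∀ t : ℚ, (∀ p, p ≤ n → t + p + 1 ≠ 0) →
      pfEval n 6 c2 t = ((X + C 1) * (numR n).comp (X + C 1)).eval t / poch (t + 1) (n + 1) ^ 6 := by
    intro t ht
    rw [hc2def, pfEval_linMul n 0 c1 t ht, hz1, sub_zero, hc1 t ht, eval_mul, eval_add, eval_X, eval_C]
    ring
  have hl2 : l1 n 6 c2 ≤ (1 + n) * l1 n 6 c1 := l1_linMul_le n _ _ c1 fun p hp => by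
    have hp' : ((p : ℕ) : ℚ) ≤ n := by exact_mod_cast hp
    rw [zero_sub, abs_neg, Nat.abs_cast]
    exact hp'
  -- `c3`: data of `(t+1+n)(t+1)(t + 1 + n/2) R_n`
  have hdeg2 : ((X + C 1) * (numR n).comp (X + C 1)).natDegree + 2 ≤ 6 * (n + 1) := by
    have h1 : ((X + C (1 : ℚ)) * (numR n).comp (X + C 1)).natDegree ≤ 1 + (2 * n + 1) := by
      refine natDegree_mul_le.trans ?_
      rw [natDegree_X_add_C, natDegree_comp, natDegree_X_add_C, mul_one]
      exact add_le_add le_rfl (natDegree_numR_le n)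
    omega
  have hz2 : ∑ p ∈ range (n + 1), c2 0 p = 0 :=
    partialFractions_sum_order_zero n 6 (by norm_num) _ hdeg2 c2 hc2
  set c3 := linMul (n : ℚ) c2 with hc3def
  have hc3 : ∀ t : ℚ, (∀ p, p ≤ n → t + p + 1 ≠ 0) →
      pfEval n 6 c3 t = (t + 1 + n) * ((t + 1) * ((t + 1 + n / 2) * R 6 1 n t)) := by
    intro t ht
    rw [hc3def, pfEval_linMul n _ c2 t ht, hz2, sub_zero, hc2 t ht, eval_mul, eval_add, eval_X, eval_C,
      mul_div_assoc, quot_numR_eq]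
  have hl3 : l1 n 6 c3 ≤ (1 + n) * l1 n 6 c2 := l1_linMul_le n _ _ c2 fun p hp => by
    have hp' : ((p : ℕ) : ℚ) ≤ n := by exact_mod_cast hp
    rw [abs_le]
    constructor <;> linarith [(p.cast_nonneg : (0 : ℚ) ≤ p)]
  -- `ct = −c3`: data of `r̃ₙ`
  refine ⟨c1, fun o p => (-1 : ℚ) * c3 o p, hc1, fun t ht => ?_, ?_, ?_⟩
  · rw [pfEval_const_mul, hc3 t ht, quot_numRt_eq]
    ring
  · calc l1 n 6 c1 ≤ (1 + n / 2) * l1 n 6 c0 := hl1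
      _ ≤ ((n : ℚ) + 1) * (720 * B) := mul_le_mul (by linarith [(n.cast_nonneg : (0 : ℚ) ≤ n)]) hB hl00
          (by positivity)
      _ = 720 * ((n : ℚ) + 1) * B := by ring
  · have hl10 : 0 ≤ l1 n 6 c1 := sum_nonneg fun _ _ => sum_nonneg fun _ _ => abs_nonneg _
    have hl20 : 0 ≤ l1 n 6 c2 := sum_nonneg fun _ _ => sum_nonneg fun _ _ => abs_nonneg _
    rw [l1_neg]
    calc l1 n 6 c3 ≤ (1 + n) * l1 n 6 c2 := hl3
      _ ≤ (1 + n) * ((1 + n) * l1 n 6 c1) := mul_le_mul_of_nonneg_left hl2 (by positivity)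
      _ ≤ (1 + n) * ((1 + n) * ((1 + n / 2) * l1 n 6 c0)) := by gcongr
      _ ≤ (1 + n) * ((1 + n) * ((1 + n) * (720 * B))) := by
          gcongr (1 + (n : ℚ)) * ((1 + n) * ?_)
          exact mul_le_mul (by linarith [(n.cast_nonneg : (0 : ℚ) ≤ n)]) hB hl00 (by positivity)
      _ = 720 * ((n : ℚ) + 1) ^ 3 * B := by ring

/-- The common coefficient bound `720(n+1)³·64ⁿ·C(2n,n)² (≤ 720(n+1)³·1024ⁿ)`. [cite: Zudilin2002Zeta5, Sect. 2 ((11), (13): the true rate is `λ₃ⁿ`)] -/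
def coeffBound (n : ℕ) : ℚ := 720 * ((n : ℚ) + 1) ^ 3 * (64 ^ n * (Nat.centralBinom n : ℚ) ^ 2)

/-- **Size of the coefficients**: `|uₙ|, |wₙ|, |ũₙ|, |w̃ₙ| ≤ 720(n+1)³·64ⁿ·C(2n,n)²`. [cite: Zudilin2002Zeta5, Sect. 2 ((11), (13))] -/
theorem abs_coeff_le (n : ℕ) :
    |uC n| ≤ coeffBound n ∧ |wC n| ≤ coeffBound n ∧ |utC n| ≤ coeffBound n ∧ |wtC n| ≤ coeffBound n := by
  obtain ⟨c, ct, hc, hct, hl, hlt⟩ := exists_data_l1_le n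
  have hB0 : 0 ≤ 64 ^ n * (Nat.centralBinom n : ℚ) ^ 2 := by positivity
  have hmono : 720 * ((n : ℚ) + 1) * (64 ^ n * (Nat.centralBinom n : ℚ) ^ 2) ≤ coeffBound n := by
    unfold coeffBound
    refine mul_le_mul_of_nonneg_right (mul_le_mul_of_nonneg_left ?_ (by norm_num)) hB0
    have h1 : (1 : ℚ) ≤ (n : ℚ) + 1 := by linarith [(n.cast_nonneg : (0 : ℚ) ≤ n)]
    calc (n : ℚ) + 1 = ((n : ℚ) + 1) * 1 * 1 := by ring
      _ ≤ ((n : ℚ) + 1) * ((n : ℚ) + 1) * ((n : ℚ) + 1) := by gcongr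
      _ = ((n : ℚ) + 1) ^ 3 := by ring
  refine ⟨?_, ?_, ?_, ?_⟩
  · rw [uC_eq hc]; exact ((abs_sum_le_l1 n c (by norm_num)).trans hl).trans hmono
  · rw [wC_eq hc]; exact ((abs_sum_le_l1 n c (by norm_num)).trans hl).trans hmono
  · rw [utC_eq hct]; exact (abs_sum_le_l1 n ct (by norm_num)).trans hlt
  · rw [wtC_eq hct]; exact (abs_sum_le_l1 n ct (by norm_num)).trans hlt

/-! ### The first values ("An easy verification shows that …"): `n = 0` and `n = 1`

`r₀ = ζ(5)`, `r̃₀ = −ζ(3)` (sic: the displayed (7) gives `−Σ_k k³/k⁶`; the source prints `ζ(3)`),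
`r₁ = 9ζ(5) + 33ζ(3) − 49`, `r̃₁ = 2ζ(5) + 12ζ(3) − 33/2`, from explicit partial-fraction data; with the tree's
`q₀ = −1, q₁ = 42, p₁ = 87/2, p̃₁ = 101/2` this confirms (15) at `n = 0, 1` in the present normalisation. -/

/-- Data of `r₀`: `k/k⁶ = 1/k⁵`. [cite: Zudilin2002Zeta5, Sect. 2 (values after (7))] -/
def dataR0 : ℕ → ℕ → ℚ := fun o p => if o = 4 ∧ p = 0 then 1 else 0

/-- Data of `r̃₀`: `−k³/k⁶ = −1/k³`. [cite: Zudilin2002Zeta5, Sect. 2 (values after (7))] -/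
def dataRt0 : ℕ → ℕ → ℚ := fun o p => if o = 2 ∧ p = 0 then -1 else 0

/-- Data of `r₁`: `(k+1/2)(k−1)(k+2)/(k(k+1))⁶` by pole (`p = 0`: pole `k = 0`; `p = 1`: pole `k = −1`) and order `o + 1`.
[cite: Zudilin2002Zeta5, Sect. 2 (values after (7))] -/
def dataR1 : ℕ → ℕ → ℚ := fun o p =>
  if p = 0 then (if o = 1 then -33 / 2 else if o = 2 then 33 / 2 else if o = 3 then -21 / 2
    else if o = 4 then 9 / 2 else if o = 5 then -1 else 0)
  else if p = 1 then (if o = 1 then 33 / 2 else if o = 2 then 33 / 2 else if o = 3 then 21 / 2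
    else if o = 4 then 9 / 2 else if o = 5 then 1 else 0)
  else 0

/-- Data of `r̃₁`: `−(k+1/2)(k−1)k(k+1)(k+2)/(k(k+1))⁶`. [cite: Zudilin2002Zeta5, Sect. 2 (values after (7))] -/
def dataRt1 : ℕ → ℕ → ℚ := fun o p =>
  if p = 0 then (if o = 1 then -6 else if o = 2 then 6 else if o = 3 then -7 / 2 else if o = 4 then 1 else 0)
  else if p = 1 then (if o = 1 then 6 else if o = 2 then 6 else if o = 3 then 7 / 2 else if o = 4 then 1 else 0)
  else 0

/-- `dataR0` are data of `r₀`. [cite: Zudilin2002Zeta5, Sect. 2 (values after (7))] -/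
theorem isDataR_zero : IsDataR 0 dataR0 := by
  intro t ht
  have h1 : t + 1 ≠ 0 := by have := ht 0 le_rfl; simpa using this
  rw [quot_numR_eq, R_six_one_eq]
  simp [pfEval, Finset.sum_range_succ, dataR0, poch]
  field_simp

/-- `dataRt0` are data of `r̃₀`. [cite: Zudilin2002Zeta5, Sect. 2 (values after (7))] -/
theorem isDataRt_zero : IsDataRt 0 dataRt0 := by
  intro t ht
  have h1 : t + 1 ≠ 0 := by have := ht 0 le_rfl; simpa using this
  rw [quot_numRt_eq, R_six_one_eq]
  simp [pfEval, Finset.sum_range_succ, dataRt0, poch]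
  field_simp

/-- `dataR1` are data of `r₁`. [cite: Zudilin2002Zeta5, Sect. 2 (values after (7))] -/
theorem isDataR_one : IsDataR 1 dataR1 := by
  intro t ht
  have h1 : t + 1 ≠ 0 := by have h := ht 0 (by norm_num); simpa using h
  have h2 : t + 1 + 1 ≠ 0 := by have h := ht 1 le_rfl; push_cast at h; exact h
  rw [quot_numR_eq, R_six_one_eq]
  simp [pfEval, Finset.sum_range_succ, dataR1, poch, Finset.prod_range_succ]
  field_simp
  ring

/-- `dataRt1` are data of `r̃₁`. [cite: Zudilin2002Zeta5, Sect. 2 (values after (7))] -/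
theorem isDataRt_one : IsDataRt 1 dataRt1 := by
  intro t ht
  have h1 : t + 1 ≠ 0 := by have h := ht 0 (by norm_num); simpa using h
  have h2 : t + 1 + 1 ≠ 0 := by have h := ht 1 le_rfl; push_cast at h; exact h
  rw [quot_numRt_eq, R_six_one_eq]
  simp [pfEval, Finset.sum_range_succ, dataRt1, poch, Finset.prod_range_succ]
  field_simp
  ring

/-- **`r₀ = ζ(5)`, `r̃₀ = −ζ(3)`**: `u₀ = 1, w₀ = v₀ = 0`; `ũ₀ = 0, w̃₀ = −1, ṽ₀ = 0`.
[cite: Zudilin2002Zeta5, Sect. 2 (values after (7); the printed `r̃₀ = ζ(3)` is a sign misprint)] -/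
theorem values_zero : uC 0 = 1 ∧ wC 0 = 0 ∧ vC 0 = 0 ∧ utC 0 = 0 ∧ wtC 0 = -1 ∧ vtC 0 = 0 := by
  refine ⟨?_, ?_, ?_, ?_, ?_, ?_⟩
  · rw [uC_eq isDataR_zero]; simp [dataR0]
  · rw [wC_eq isDataR_zero]; simp [dataR0]
  · rw [vC_eq isDataR_zero]; simp [dataR0, harm]
  · rw [utC_eq isDataRt_zero]; simp [dataRt0]
  · rw [wtC_eq isDataRt_zero]; simp [dataRt0]
  · rw [vtC_eq isDataRt_zero]; simp [dataRt0, harm]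

/-- **`r₁ = 9ζ(5) + 33ζ(3) − 49`, `r̃₁ = 2ζ(5) + 12ζ(3) − 33/2`** (the printed values).
[cite: Zudilin2002Zeta5, Sect. 2 (values after (7))] -/
theorem values_one : uC 1 = 9 ∧ wC 1 = 33 ∧ vC 1 = 49 ∧ utC 1 = 2 ∧ wtC 1 = 12 ∧ vtC 1 = 33 / 2 := by
  refine ⟨?_, ?_, ?_, ?_, ?_, ?_⟩
  · rw [uC_eq isDataR_one]; norm_num [dataR1, Finset.sum_range_succ]
  · rw [wC_eq isDataR_one]; norm_num [dataR1, Finset.sum_range_succ]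
  · rw [vC_eq isDataR_one]; norm_num [dataR1, harm, Finset.sum_range_succ]
  · rw [utC_eq isDataRt_one]; norm_num [dataRt1, Finset.sum_range_succ]
  · rw [wtC_eq isDataRt_one]; norm_num [dataRt1, Finset.sum_range_succ]
  · rw [vtC_eq isDataRt_one]; norm_num [dataRt1, harm, Finset.sum_range_succ]

/-- `r₀ = ζ(5)` and `r̃₀ = −ζ(3)`. [cite: Zudilin2002Zeta5, Sect. 2 (values after (7))] -/
theorem rForm_zero : rForm 0 = zetaValue 5 ∧ rtForm 0 = -zetaValue 3 := by
  obtain ⟨h1, h2, h3, h4, h5, h6⟩ := values_zero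
  rw [rForm_eq, rtForm_eq, h1, h2, h3, h4, h5, h6]
  push_cast
  constructor <;> ring

/-- **(15) at `n = 0` and `n = 1`** in the present normalisation, against the tree's `q₀ = −1`, `q₁ = 42`,
`p₁ = 87/2`, `p̃₁ = 101/2` (`p₀ = p̃₀ = 0`): e.g. `q₁ = u₁w̃₁ − ũ₁w₁ = 9·12 − 2·33 = 42`.
[cite: Zudilin2002Zeta5, Sect. 2, eq. (15)] -/
theorem eq15_zero_one :
    (q 0 = uC 0 * wtC 0 - utC 0 * wC 0 ∧ p 0 = wtC 0 * vC 0 - wC 0 * vtC 0 ∧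
      ptilde 0 = uC 0 * vtC 0 - utC 0 * vC 0) ∧
    (q 1 = uC 1 * wtC 1 - utC 1 * wC 1 ∧ p 1 = wtC 1 * vC 1 - wC 1 * vtC 1 ∧
      ptilde 1 = uC 1 * vtC 1 - utC 1 * vC 1) := by
  obtain ⟨h1, h2, h3, h4, h5, h6⟩ := values_zero
  obtain ⟨g1, g2, g3, g4, g5, g6⟩ := values_one
  rw [h1, h2, h3, h4, h5, h6, g1, g2, g3, g4, g5, g6]
  norm_num [q, p, ptilde, sol]

/-! ### Theorem 1 from the identities (15) -/

/-- `Qₙ ≥ C(2n,n)²`: the term `k₁ = k₂ = n` of Brown–Zudilin's double sum (7) for `Qₙ` is `C(2n,n)²C(3n,n)`.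
[cite: BrownZudilin2022, Sect. 2, eq. (7)] -/
private theorem centralBinom_sq_le_Q (n : ℕ) : Nat.centralBinom n ^ 2 ≤ BrownZudilin2022.Q n := by
  unfold BrownZudilin2022.Q
  have hn : n ∈ range (n + 1) := mem_range.2 (Nat.lt_succ_self n)
  refine le_trans ?_ (single_le_sum (fun k _ => Nat.zero_le _) hn)
  refine le_trans ?_ (single_le_sum (f := fun k₂ => (n + n).choose n * n.choose n ^ 2 *
    ((n + k₂).choose n * n.choose k₂ ^ 2 * (n + n + k₂).choose n)) (fun k _ => Nat.zero_le _) hn)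
  rw [Nat.choose_self, Nat.centralBinom_eq_two_mul_choose, two_mul]
  have h3 : 1 ≤ (n + n + n).choose n := Nat.choose_pos (by omega)
  calc ((n + n).choose n) ^ 2 = (n + n).choose n * 1 ^ 2 * ((n + n).choose n * 1 ^ 2 * 1) := by ring
    _ ≤ (n + n).choose n * 1 ^ 2 * ((n + n).choose n * 1 ^ 2 * (n + n + n).choose n) := by gcongr

/-- `|qₙ| ≥ C(2n,n)³` under `Q_solvesRec`: `qₙ = (−1)^{n+1}C(2n,n)Qₙ` (the tree's gauge) and `Qₙ ≥ C(2n,n)²`.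
[cite: BrownZudilin2022, Sect. 2 (remark after (7))] -/
private theorem centralBinom_cube_le_abs_q (hQ : BrownZudilin2022.Q_solvesRec) (n : ℕ) :
    (Nat.centralBinom n : ℚ) ^ 3 ≤ |q n| := by
  have hQ0 : BrownZudilin2022.Q 0 = 1 ∧ BrownZudilin2022.Q 1 = 21 ∧ BrownZudilin2022.Q 2 = 2989 := by
    refine ⟨?_, ?_, ?_⟩ <;> decide
  have hsol : (fun m => (BrownZudilin2022.Q m : ℚ)) = BrownZudilin2022.Qsol :=
    BrownZudilin2022.SolvesRec.ext_of_init hQ (BrownZudilin2022.recSol_solvesRec 1 21 2989)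
      (by simp [hQ0.1, BrownZudilin2022.Qsol]) (by simp [hQ0.2.1, BrownZudilin2022.Qsol])
      (by simp [hQ0.2.2, BrownZudilin2022.Qsol])
  have hQn : BrownZudilin2022.Qsol n = (BrownZudilin2022.Q n : ℚ) := by
    have h := congrFun hsol n
    exact h.symm
  have hq : q n = (-1) ^ (n + 1) * (Nat.centralBinom n : ℚ) * (BrownZudilin2022.Q n : ℚ) := by
    rw [BrownZudilin2022.q_eq_gauge, BrownZudilin2022.gauge, hQn]
  rw [hq, abs_mul, abs_mul, abs_pow, abs_neg, abs_one, one_pow, one_mul, Nat.abs_cast, Nat.abs_cast]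
  have h' : (Nat.centralBinom n : ℚ) ^ 2 ≤ (BrownZudilin2022.Q n : ℚ) := by
    exact_mod_cast centralBinom_sq_le_Q n
  calc (Nat.centralBinom n : ℚ) ^ 3 = (Nat.centralBinom n : ℚ) * (Nat.centralBinom n : ℚ) ^ 2 := by ring
    _ ≤ (Nat.centralBinom n : ℚ) * (BrownZudilin2022.Q n : ℚ) := mul_le_mul_of_nonneg_left h' (by positivity)

/-- **Theorem 1 of [Zudilin2002Zeta5] from the identities (15)** (the last paragraph of Sect. 2, with the crude
estimates of this file in place of (11), (13) and Poincaré's theorem): if the solutions `qₙ, pₙ, p̃ₙ` of the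
recursion (1) satisfy, for all large `n`,
(15) `qₙ = uₙw̃ₙ − ũₙwₙ`, `pₙ = w̃ₙvₙ − wₙṽₙ`, `p̃ₙ = uₙṽₙ − ũₙvₙ`,
and Brown–Zudilin's binomial sum solves their recursion (`Q_solvesRec`, discharged in the tree; it yields
`|qₙ| = C(2n,n)Qₙ ≥ C(2n,n)³`), then `ℓₙ = qₙζ(5) − pₙ = w̃ₙrₙ − wₙr̃ₙ → 0` and `ℓ̃ₙ = qₙζ(3) − p̃ₙ = uₙr̃ₙ − ũₙrₙ → 0`
fast enough that **`pₙ/qₙ → ζ(5)` and `p̃ₙ/qₙ → ζ(3)`**. [cite: Zudilin2002Zeta5, Theorem 1 with Sect. 2, (15)] -/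
theorem tendsto_of_eq15 (hQ : BrownZudilin2022.Q_solvesRec)
    (h15 : ∀ᶠ n : ℕ in atTop, q n = uC n * wtC n - utC n * wC n ∧ p n = wtC n * vC n - wC n * vtC n ∧
      ptilde n = uC n * vtC n - utC n * vC n) :
    Tendsto (fun n : ℕ => (p n : ℝ) / q n) atTop (𝓝 (zetaValue 5)) ∧
      Tendsto (fun n : ℕ => (ptilde n : ℝ) / q n) atTop (𝓝 (zetaValue 3)) := by
  have hζ2 : 0 ≤ zetaValue 2 := tsum_nonneg fun k => by positivity
  -- the majorant `B n = 6480 ζ(2) (n+1)⁸/8ⁿ → 0`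
  set B : ℕ → ℝ := fun n => 6480 * zetaValue 2 * ((n : ℝ) + 1) ^ 8 / 8 ^ n with hBdef
  have hB : Tendsto B atTop (𝓝 0) := by
    have h1 := (tendsto_pow_const_div_const_pow_of_one_lt 8 (by norm_num : (1 : ℝ) < 8)).comp
      (tendsto_add_atTop_nat 1)
    have h2 := h1.const_mul (6480 * zetaValue 2 * 8)
    rw [mul_zero] at h2
    refine h2.congr fun n => ?_
    simp only [Function.comp_apply, hBdef]
    push_cast
    field_simp
    ring
  -- the estimate at every `n` where (15) holds
  have key : ∀ n : ℕ, q n = uC n * wtC n - utC n * wC n → p n = wtC n * vC n - wC n * vtC n →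
      ptilde n = uC n * vtC n - utC n * vC n →
      |(p n : ℝ) / q n - zetaValue 5| ≤ B n ∧ |(ptilde n : ℝ) / q n - zetaValue 3| ≤ B n := by
    intro n hq hp hpt
    set C : ℝ := (Nat.centralBinom n : ℝ) with hCdef
    have hCpos : 0 < C := by rw [hCdef]; exact_mod_cast Nat.centralBinom_pos n
    have hC4 : (4 : ℝ) ^ n ≤ (2 * n + 1) * C := by
      rw [hCdef]; exact_mod_cast Nat.four_pow_le_two_mul_add_one_mul_central_binom n
    have hq3 : C ^ 3 ≤ |(q n : ℝ)| := by
      have h' := (Rat.cast_le (K := ℝ)).2 (centralBinom_cube_le_abs_q hQ n)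
      push_cast at h'
      rw [hCdef]
      exact h'
    have hqpos : 0 < |(q n : ℝ)| := lt_of_lt_of_le (by positivity) hq3
    have hq0 : (q n : ℝ) ≠ 0 := abs_pos.1 hqpos
    -- sizes of the coefficients and of the forms
    obtain ⟨hu, hw, hut, hwt⟩ := abs_coeff_le n
    set K : ℝ := ((coeffBound n : ℚ) : ℝ) with hKdef
    have hK : K = 720 * ((n : ℝ) + 1) ^ 3 * (64 ^ n * C ^ 2) := by
      rw [hKdef, coeffBound, hCdef]
      push_cast
      ring
    have hK0 : 0 ≤ K := by rw [hK]; positivity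
    have huR : |(uC n : ℝ)| ≤ K := by
      have h := (Rat.cast_le (K := ℝ)).2 hu; push_cast at h; exact h
    have hwR : |(wC n : ℝ)| ≤ K := by
      have h := (Rat.cast_le (K := ℝ)).2 hw; push_cast at h; exact h
    have hutR : |(utC n : ℝ)| ≤ K := by
      have h := (Rat.cast_le (K := ℝ)).2 hut; push_cast at h; exact h
    have hwtR : |(wtC n : ℝ)| ≤ K := by
      have h := (Rat.cast_le (K := ℝ)).2 hwt; push_cast at h; exact h
    set D : ℝ := ((n : ℝ) + 1) ^ 4 / 128 ^ n * zetaValue 2 with hDdef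
    have hD0 : 0 ≤ D := by positivity
    have hr0 := rForm_pos n
    have hrt0 := rtForm_neg n
    have hr : rForm n ≤ 3 / 2 * D := by
      have h := rForm_le n
      have e : 3 / 2 * ((n : ℝ) + 1) ^ 4 / 128 ^ n * zetaValue 2 = 3 / 2 * D := by rw [hDdef]; ring
      rwa [e] at h
    have hrt : -rtForm n ≤ 3 * D := by
      have h := neg_rtForm_le n
      have e : 3 * ((n : ℝ) + 1) ^ 4 / 128 ^ n * zetaValue 2 = 3 * D := by rw [hDdef]; ring
      rwa [e] at h
    -- the forms `ℓₙ, ℓ̃ₙ` of the source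
    have hl : (q n : ℝ) * zetaValue 5 - p n = (wtC n : ℝ) * rForm n - (wC n : ℝ) * rtForm n := by
      rw [hq, hp, rForm_eq, rtForm_eq]
      push_cast
      ring
    have hlt : (q n : ℝ) * zetaValue 3 - ptilde n = (uC n : ℝ) * rtForm n - (utC n : ℝ) * rForm n := by
      rw [hq, hpt, rForm_eq, rtForm_eq]
      push_cast
      ring
    have hlle : |(q n : ℝ) * zetaValue 5 - p n| ≤ K * (9 / 2 * D) := by
      rw [hl]
      refine (abs_sub _ _).trans ?_
      rw [abs_mul, abs_mul, abs_of_pos hr0, abs_of_neg hrt0]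
      have h1 : |(wtC n : ℝ)| * rForm n ≤ K * (3 / 2 * D) := mul_le_mul hwtR hr hr0.le hK0
      have h2 : |(wC n : ℝ)| * -rtForm n ≤ K * (3 * D) := mul_le_mul hwR hrt (by linarith) hK0
      linarith
    have hltle : |(q n : ℝ) * zetaValue 3 - ptilde n| ≤ K * (9 / 2 * D) := by
      rw [hlt]
      refine (abs_sub _ _).trans ?_
      rw [abs_mul, abs_mul, abs_of_pos hr0, abs_of_neg hrt0]
      have h1 : |(uC n : ℝ)| * -rtForm n ≤ K * (3 * D) := mul_le_mul huR hrt (by linarith) hK0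
      have h2 : |(utC n : ℝ)| * rForm n ≤ K * (3 / 2 * D) := mul_le_mul hutR hr hr0.le hK0
      linarith
    -- the majorant: `K·(9/2)D / C³ = 3240 ζ(2) (n+1)⁷/(2ⁿ C) ≤ B n`
    have h128 : (128 : ℝ) ^ n = 2 ^ n * 64 ^ n := by
      rw [← mul_pow]; norm_num
    have h8 : (8 : ℝ) ^ n ≤ 2 * ((n : ℝ) + 1) * 2 ^ n * C := by
      have e : (8 : ℝ) ^ n = 2 ^ n * 4 ^ n := by rw [← mul_pow]; norm_num
      rw [e]
      calc (2 : ℝ) ^ n * 4 ^ n ≤ 2 ^ n * ((2 * n + 1) * C) := mul_le_mul_of_nonneg_left hC4 (by positivity)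
        _ ≤ 2 ^ n * ((2 * ((n : ℝ) + 1)) * C) := by gcongr; linarith
        _ = 2 * ((n : ℝ) + 1) * 2 ^ n * C := by ring
    have hmaj : K * (9 / 2 * D) / C ^ 3 ≤ B n := by
      have e : K * (9 / 2 * D) / C ^ 3 = 3240 * zetaValue 2 * ((n : ℝ) + 1) ^ 7 / (2 ^ n * C) := by
        rw [hK, hDdef, h128]
        field_simp
        ring
      rw [e, hBdef]
      simp only
      rw [div_le_div_iff₀ (by positivity) (by positivity)]
      calc 3240 * zetaValue 2 * ((n : ℝ) + 1) ^ 7 * 8 ^ n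
          ≤ 3240 * zetaValue 2 * ((n : ℝ) + 1) ^ 7 * (2 * ((n : ℝ) + 1) * 2 ^ n * C) :=
            mul_le_mul_of_nonneg_left h8 (by positivity)
        _ = 6480 * zetaValue 2 * ((n : ℝ) + 1) ^ 8 * (2 ^ n * C) := by ring
    -- division by `qₙ`
    have hdiv : ∀ x y : ℝ, |(q n : ℝ) * x - y| ≤ K * (9 / 2 * D) → |y / q n - x| ≤ B n := by
      intro x y h
      rw [show y / q n - x = -(((q n : ℝ) * x - y) / q n) by field_simp; ring, abs_neg, abs_div]
      calc |(q n : ℝ) * x - y| / |(q n : ℝ)| ≤ K * (9 / 2 * D) / |(q n : ℝ)| :=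
            div_le_div_of_nonneg_right h hqpos.le
        _ ≤ K * (9 / 2 * D) / C ^ 3 := div_le_div_of_nonneg_left (by positivity) (by positivity) hq3
        _ ≤ B n := hmaj
    exact ⟨hdiv _ _ hlle, hdiv _ _ hltle⟩
  -- conclusion
  have hev5 : ∀ᶠ n : ℕ in atTop, ‖(p n : ℝ) / q n - zetaValue 5‖ ≤ B n := by
    filter_upwards [h15] with n hn
    exact (key n hn.1 hn.2.1 hn.2.2).1
  have hev3 : ∀ᶠ n : ℕ in atTop, ‖(ptilde n : ℝ) / q n - zetaValue 3‖ ≤ B n := by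
    filter_upwards [h15] with n hn
    exact (key n hn.1 hn.2.1 hn.2.2).2
  exact ⟨tendsto_sub_nhds_zero_iff.1 (squeeze_zero_norm' hev5 hB),
    tendsto_sub_nhds_zero_iff.1 (squeeze_zero_norm' hev3 hB)⟩

/-! ### The values at `n = 2`, (15) at `n = 2`, and Theorem 1 from "the minors solve (1)"

With `n = 0, 1, 2` checked, the identities (15) for ALL `n` — hence Theorem 1's limits — follow as soon as the
three minor sequences `uₙw̃ₙ − ũₙwₙ`, `w̃ₙvₙ − wₙṽₙ`, `uₙṽₙ − ũₙvₙ` are known to satisfy the recursion (1)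
(`Zudilin2002.IsSolution`; uniqueness `IsSolution.ext_of_init`): `tendsto_of_minors_isSolution`. -/

/-- Data of `r₂`: `16(k+1)(k−1)(k−2)(k+3)(k+4)/(k(k+1)(k+2))⁶` by pole `p` (`k = −p`) and order `o + 1`.
[cite: Zudilin2002Zeta5, Sect. 2 (values after (7))] -/
def dataR2 : ℕ → ℕ → ℚ := fun o p =>
  if p = 0 then (if o = 0 then -5432 else if o = 1 then 37331 / 16 else if o = 2 then -6867 / 8
    else if o = 3 then 1015 / 4 else if o = 4 then -107 / 2 else if o = 5 then 6 else 0)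
  else if p = 1 then (if o = 0 then 10864 else if o = 2 then 3248 else if o = 4 then 576 else 0)
  else if p = 2 then (if o = 0 then -5432 else if o = 1 then -37331 / 16 else if o = 2 then -6867 / 8
    else if o = 3 then -1015 / 4 else if o = 4 then -107 / 2 else if o = 5 then -6 else 0)
  else 0

/-- Data of `r̃₂`. [cite: Zudilin2002Zeta5, Sect. 2 (values after (7))] -/
def dataRt2 : ℕ → ℕ → ℚ := fun o p =>
  if p = 0 then (if o = 0 then -3808 else if o = 1 then 1463 else if o = 2 then -454
    else if o = 3 then 101 else if o = 4 then -12 else 0)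
  else if p = 1 then (if o = 0 then 7616 else if o = 2 then 2672 else if o = 4 then 576 else 0)
  else if p = 2 then (if o = 0 then -3808 else if o = 1 then -1463 else if o = 2 then -454
    else if o = 3 then -101 else if o = 4 then -12 else 0)
  else 0

/-- `dataR2` are data of `r₂`. [cite: Zudilin2002Zeta5, Sect. 2 (values after (7))] -/
theorem isDataR_two : IsDataR 2 dataR2 := by
  intro t ht
  have h1 : t + 1 ≠ 0 := by have h := ht 0 (by norm_num); simpa using h
  have h2 : t + 1 + 1 ≠ 0 := by have h := ht 1 (by norm_num); push_cast at h; exact h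
  have h3 : t + 2 + 1 ≠ 0 := by have h := ht 2 le_rfl; push_cast at h; exact h
  have h3' : t + 1 + 2 ≠ 0 := by rw [add_assoc, add_comm 1 2, ← add_assoc]; exact h3
  have h3'' : t + 3 ≠ 0 := by rw [show (3 : ℚ) = 2 + 1 by norm_num, ← add_assoc]; exact h3
  rw [quot_numR_eq, R_six_one_eq]
  simp [pfEval, Finset.sum_range_succ, dataR2, poch, Finset.prod_range_succ]
  field_simp
  ring

/-- `dataRt2` are data of `r̃₂`. [cite: Zudilin2002Zeta5, Sect. 2 (values after (7))] -/
theorem isDataRt_two : IsDataRt 2 dataRt2 := by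
  intro t ht
  have h1 : t + 1 ≠ 0 := by have h := ht 0 (by norm_num); simpa using h
  have h2 : t + 1 + 1 ≠ 0 := by have h := ht 1 (by norm_num); push_cast at h; exact h
  have h3 : t + 2 + 1 ≠ 0 := by have h := ht 2 le_rfl; push_cast at h; exact h
  have h3' : t + 1 + 2 ≠ 0 := by rw [add_assoc, add_comm 1 2, ← add_assoc]; exact h3
  have h3'' : t + 3 ≠ 0 := by rw [show (3 : ℚ) = 2 + 1 by norm_num, ← add_assoc]; exact h3
  rw [quot_numRt_eq, R_six_one_eq]
  simp [pfEval, Finset.sum_range_succ, dataRt2, poch, Finset.prod_range_succ]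
  field_simp
  ring

/-- **`r₂ = 469ζ(5) + (6125/4)ζ(3) − 74463/32`, `r̃₂ = 552ζ(5) + 1764ζ(3) − 43085/16`** (the printed values).
[cite: Zudilin2002Zeta5, Sect. 2 (values after (7))] -/
theorem values_two : uC 2 = 469 ∧ wC 2 = 6125 / 4 ∧ vC 2 = 74463 / 32 ∧
    utC 2 = 552 ∧ wtC 2 = 1764 ∧ vtC 2 = 43085 / 16 := by
  refine ⟨?_, ?_, ?_, ?_, ?_, ?_⟩
  · rw [uC_eq isDataR_two]; norm_num [dataR2, Finset.sum_range_succ]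
  · rw [wC_eq isDataR_two]; norm_num [dataR2, Finset.sum_range_succ]
  · rw [vC_eq isDataR_two]; norm_num [dataR2, harm, Finset.sum_range_succ]
  · rw [utC_eq isDataRt_two]; norm_num [dataRt2, Finset.sum_range_succ]
  · rw [wtC_eq isDataRt_two]; norm_num [dataRt2, Finset.sum_range_succ]
  · rw [vtC_eq isDataRt_two]; norm_num [dataRt2, harm, Finset.sum_range_succ]

/-- **(15) at `n = 2`**: `q₂ = −17934 = 469·1764 − 552·6125/4`, `p₂ = −1190161/64`, `p̃₂ = −344923/16`.
[cite: Zudilin2002Zeta5, Sect. 2, eq. (15)] -/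
theorem eq15_two :
    q 2 = uC 2 * wtC 2 - utC 2 * wC 2 ∧ p 2 = wtC 2 * vC 2 - wC 2 * vtC 2 ∧
      ptilde 2 = uC 2 * vtC 2 - utC 2 * vC 2 := by
  obtain ⟨g1, g2, g3, g4, g5, g6⟩ := values_two
  rw [g1, g2, g3, g4, g5, g6]
  norm_num [q, p, ptilde, sol]

/-- The minor `qₙ* = uₙw̃ₙ − ũₙwₙ` of (15). [cite: Zudilin2002Zeta5, Sect. 2, eq. (15)] -/
def minorQ (n : ℕ) : ℚ := uC n * wtC n - utC n * wC n

/-- The minor `pₙ* = w̃ₙvₙ − wₙṽₙ` of (15). [cite: Zudilin2002Zeta5, Sect. 2, eq. (15)] -/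
def minorP (n : ℕ) : ℚ := wtC n * vC n - wC n * vtC n

/-- The minor `p̃ₙ* = uₙṽₙ − ũₙvₙ` of (15). [cite: Zudilin2002Zeta5, Sect. 2, eq. (15)] -/
def minorPt (n : ℕ) : ℚ := uC n * vtC n - utC n * vC n

/-- **(15) for all `n` from the recursion**: if the three minor sequences satisfy the recursion (1), they ARE
`qₙ, pₙ, p̃ₙ` (same initial data at `n = 0, 1, 2`: `eq15_zero_one`, `eq15_two`).
[cite: Zudilin2002Zeta5, Sect. 2 ((15) with "that also satisfy the difference equation (1)")] -/
theorem eq15_of_isSolution (hq : IsSolution minorQ) (hp : IsSolution minorP) (hpt : IsSolution minorPt) :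
    q = minorQ ∧ p = minorP ∧ ptilde = minorPt := by
  obtain ⟨⟨a1, a2, a3⟩, b1, b2, b3⟩ := eq15_zero_one
  obtain ⟨c1, c2, c3⟩ := eq15_two
  exact ⟨(sol_isSolution _ _ _).ext_of_init hq a1 b1 c1, (sol_isSolution _ _ _).ext_of_init hp a2 b2 c2,
    (sol_isSolution _ _ _).ext_of_init hpt a3 b3 c3⟩

/-- **Theorem 1's limits from "the minors solve (1)"**: if `uₙw̃ₙ − ũₙwₙ`, `w̃ₙvₙ − wₙṽₙ`, `uₙṽₙ − ũₙvₙ` satisfy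
the recursion (1) (the content of Theorems 2–3 + (15) of the source) and `Q_solvesRec` holds, then
`pₙ/qₙ → ζ(5)` and `p̃ₙ/qₙ → ζ(3)`. [cite: Zudilin2002Zeta5, Theorem 1 with Sect. 2, (15)] -/
theorem tendsto_of_minors_isSolution (hQ : BrownZudilin2022.Q_solvesRec) (hq : IsSolution minorQ)
    (hp : IsSolution minorP) (hpt : IsSolution minorPt) :
    Tendsto (fun n : ℕ => (p n : ℝ) / q n) atTop (𝓝 (zetaValue 5)) ∧
      Tendsto (fun n : ℕ => (ptilde n : ℝ) / q n) atTop (𝓝 (zetaValue 3)) := by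
  obtain ⟨e1, e2, e3⟩ := eq15_of_isSolution hq hp hpt
  refine tendsto_of_eq15 hQ (Eventually.of_forall fun n => ⟨?_, ?_, ?_⟩)
  · rw [e1]; rfl
  · rw [e2]; rfl
  · rw [e3]; rfl

/-! ### Bridge helpers: vanishing below the support and shift-invariance of the constant terms

For the cell's Summit-side identification (the symmetric ray `b = (3n; n⁷)` of Brown–Zudilin's dual family is
`(2/n!⁴)·rₙ` with the poles indexed `p = n, …, 2n` instead of `0, …, n`): the data vanish at the naturals
`t < n`, so the harmonic constant term is unchanged by the index shift. -/

/-- Data of `rₙ` evaluate to `0` at naturals `j < n` (the factor `(k−1)⋯(k−n)`). [cite: Zudilin2002Zeta5, Sect. 2, eq. (7)] -/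
theorem IsDataR.pfEval_natCast_eq_zero {n : ℕ} {c : ℕ → ℕ → ℚ} (hc : IsDataR n c) {j : ℕ} (hj : j < n) :
    pfEval n 6 c j = 0 := by
  rw [hc.pfEval_eq j (fun p _ => by positivity), R_natCast_eq_zero 6 1 n j (by omega), mul_zero]

/-- Data of `r̃ₙ` evaluate to `0` at naturals `j < n`. [cite: Zudilin2002Zeta5, Sect. 2, eq. (7)] -/
theorem IsDataRt.pfEval_natCast_eq_zero {n : ℕ} {c : ℕ → ℕ → ℚ} (hc : IsDataRt n c) {j : ℕ} (hj : j < n) :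
    pfEval n 6 c j = 0 := by
  rw [hc.pfEval_eq j (fun p _ => by positivity), R_natCast_eq_zero 6 1 n j (by omega), mul_zero, mul_zero]

/-- Shifting the harmonic index by `m` changes `Σ c_{o,p} H_{p}^{(o+1)}` by `Σ_{j<m} pfEval c j`. [folklore] -/
private theorem sum_harm_shift (n m : ℕ) (c : ℕ → ℕ → ℚ) :
    ∑ o ∈ range 6, ∑ p ∈ range (n + 1), c o p * harm (o + 1) (p + m) =
      ∑ o ∈ range 6, ∑ p ∈ range (n + 1), c o p * harm (o + 1) p + ∑ j ∈ range m, pfEval n 6 c j := by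
  have hh : ∀ o p : ℕ, harm (o + 1) (p + m) =
      harm (o + 1) p + ∑ j ∈ range m, 1 / ((j : ℚ) + p + 1) ^ (o + 1) := by
    intro o p
    rw [harm, harm, sum_range_add]
    congr 1
    exact sum_congr rfl fun j _ => by push_cast; ring
  simp_rw [hh, mul_add, sum_add_distrib]
  congr 1
  unfold pfEval
  simp_rw [mul_sum]
  rw [sum_comm]
  refine (sum_congr rfl fun p _ => sum_comm).trans ?_
  rw [sum_comm]
  refine sum_congr rfl fun j _ => sum_congr rfl fun p _ => sum_congr rfl fun o _ => ?_
  exact (div_eq_mul_one_div _ _).symm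

/-- **Shift-invariance of `vₙ`**: for data `c` of `rₙ` and `m ≤ n`, `Σ_{o,p} c_{o,p} H_{p+m}^{(o+1)} = vₙ`.
[cite: Zudilin2002Zeta5, Sect. 2 (construction of (7))] -/
theorem IsDataR.vC_eq_shift {n : ℕ} {c : ℕ → ℕ → ℚ} (hc : IsDataR n c) {m : ℕ} (hm : m ≤ n) :
    ∑ o ∈ range 6, ∑ p ∈ range (n + 1), c o p * harm (o + 1) (p + m) = vC n := by
  rw [sum_harm_shift, vC_eq hc, sum_eq_zero fun j hj => hc.pfEval_natCast_eq_zero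
    (lt_of_lt_of_le (mem_range.1 hj) hm), add_zero]

/-- **Shift-invariance of `ṽₙ`**: for data `c` of `r̃ₙ` and `m ≤ n`, `Σ_{o,p} c_{o,p} H_{p+m}^{(o+1)} = ṽₙ`.
[cite: Zudilin2002Zeta5, Sect. 2 (construction of (7))] -/
theorem IsDataRt.vtC_eq_shift {n : ℕ} {c : ℕ → ℕ → ℚ} (hc : IsDataRt n c) {m : ℕ} (hm : m ≤ n) :
    ∑ o ∈ range 6, ∑ p ∈ range (n + 1), c o p * harm (o + 1) (p + m) = vtC n := by
  rw [sum_harm_shift, vtC_eq hc, sum_eq_zero fun j hj => hc.pfEval_natCast_eq_zero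
    (lt_of_lt_of_le (mem_range.1 hj) hm), add_zero]

/-! ### The values at `n = 3` and (15) at `n = 3`

(So that a proof of "the minors solve (1)" for `n ≥ 3` by the exterior-square algebra can be completed at `n = 2`
by arithmetic: (1) at `n = 2` involves only the values at `n = 0, 1, 2, 3`.) -/

/-- Data of `r₃`. [cite: Zudilin2002Zeta5, Sect. 2 (construction of (7))] -/
def dataR3 : ℕ → ℕ → ℚ := fun o p =>
  if p = 0 then (if o = 0 then 2656395 / 32 else if o = 1 then -2128733 / 72 else if o = 2 then 106339 / 12
    else if o = 3 then -4189 / 2 else if o = 4 then 693 / 2 else if o = 5 then -30 else 0)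
  else if p = 1 then (if o = 0 then -2656395 / 32 else if o = 1 then -2253663 / 16 else if o = 2 then 437319 / 8
    else if o = 3 then -307719 / 4 else if o = 4 then 18954 else if o = 5 then -14580 else 0)
  else if p = 2 then (if o = 0 then -2656395 / 32 else if o = 1 then 2253663 / 16 else if o = 2 then 437319 / 8
    else if o = 3 then 307719 / 4 else if o = 4 then 18954 else if o = 5 then 14580 else 0)
  else if p = 3 then (if o = 0 then 2656395 / 32 else if o = 1 then 2128733 / 72 else if o = 2 then 106339 / 12
    else if o = 3 then 4189 / 2 else if o = 4 then 693 / 2 else if o = 5 then 30 else 0)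
  else 0

/-- Data of `r̃₃`. [cite: Zudilin2002Zeta5, Sect. 2 (construction of (7))] -/
def dataRt3 : ℕ → ℕ → ℚ := fun o p =>
  if p = 0 then (if o = 0 then 638685 / 8 else if o = 1 then -97961 / 4 else if o = 2 then 5937
    else if o = 3 then -2019 / 2 else if o = 4 then 90 else 0)
  else if p = 1 then (if o = 0 then -638685 / 8 else if o = 1 then -259443 else if o = 2 then 334611 / 2
    else if o = 3 then -316467 / 2 else if o = 4 then 52488 else if o = 5 then -29160 else 0)
  else if p = 2 then (if o = 0 then -638685 / 8 else if o = 1 then 259443 else if o = 2 then 334611 / 2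
    else if o = 3 then 316467 / 2 else if o = 4 then 52488 else if o = 5 then 29160 else 0)
  else if p = 3 then (if o = 0 then 638685 / 8 else if o = 1 then 97961 / 4 else if o = 2 then 5937
    else if o = 3 then 2019 / 2 else if o = 4 then 90 else 0)
  else 0

/-- `dataR3` are data of `r₃`. [cite: Zudilin2002Zeta5, Sect. 2 (construction of (7))] -/
theorem isDataR_three : IsDataR 3 dataR3 := by
  intro t ht
  have h1 : t + 1 ≠ 0 := by have h := ht 0 (by norm_num); simpa using h
  have h2 : t + 1 + 1 ≠ 0 := by have h := ht 1 (by norm_num); push_cast at h; exact h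
  have h3 : t + 2 + 1 ≠ 0 := by have h := ht 2 (by norm_num); push_cast at h; exact h
  have h3' : t + 1 + 2 ≠ 0 := by rw [add_assoc, add_comm 1 2, ← add_assoc]; exact h3
  have h3'' : t + 3 ≠ 0 := by rw [show (3 : ℚ) = 2 + 1 by norm_num, ← add_assoc]; exact h3
  have h4 : t + 3 + 1 ≠ 0 := by have h := ht 3 le_rfl; push_cast at h; exact h
  have h4' : t + 1 + 3 ≠ 0 := by rw [add_assoc, add_comm 1 3, ← add_assoc]; exact h4
  have h4'' : t + 4 ≠ 0 := by rw [show (4 : ℚ) = 3 + 1 by norm_num, ← add_assoc]; exact h4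
  rw [quot_numR_eq, R_six_one_eq]
  simp [pfEval, Finset.sum_range_succ, dataR3, poch, Finset.prod_range_succ]
  field_simp
  ring

/-- `dataRt3` are data of `r̃₃`. [cite: Zudilin2002Zeta5, Sect. 2 (construction of (7))] -/
theorem isDataRt_three : IsDataRt 3 dataRt3 := by
  intro t ht
  have h1 : t + 1 ≠ 0 := by have h := ht 0 (by norm_num); simpa using h
  have h2 : t + 1 + 1 ≠ 0 := by have h := ht 1 (by norm_num); push_cast at h; exact h
  have h3 : t + 2 + 1 ≠ 0 := by have h := ht 2 (by norm_num); push_cast at h; exact h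
  have h3' : t + 1 + 2 ≠ 0 := by rw [add_assoc, add_comm 1 2, ← add_assoc]; exact h3
  have h3'' : t + 3 ≠ 0 := by rw [show (3 : ℚ) = 2 + 1 by norm_num, ← add_assoc]; exact h3
  have h4 : t + 3 + 1 ≠ 0 := by have h := ht 3 le_rfl; push_cast at h; exact h
  have h4' : t + 1 + 3 ≠ 0 := by rw [add_assoc, add_comm 1 3, ← add_assoc]; exact h4
  have h4'' : t + 4 ≠ 0 := by rw [show (4 : ℚ) = 3 + 1 by norm_num, ← add_assoc]; exact h4
  rw [quot_numRt_eq, R_six_one_eq]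
  simp [pfEval, Finset.sum_range_succ, dataRt3, poch, Finset.prod_range_succ]
  field_simp
  ring

/-- `u₃ = 38601`, `w₃ = 1524635/12`, `v₃ = 1498833983/7776`; `ũ₃ = 105156`, `w̃₃ = 346485`, `ṽ₃ = 18919219/36`.
[cite: Zudilin2002Zeta5, Sect. 2 (construction of (7))] -/
theorem values_three : uC 3 = 38601 ∧ wC 3 = 1524635 / 12 ∧ vC 3 = 1498833983 / 7776 ∧
    utC 3 = 105156 ∧ wtC 3 = 346485 ∧ vtC 3 = 18919219 / 36 := by
  refine ⟨?_, ?_, ?_, ?_, ?_, ?_⟩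
  · rw [uC_eq isDataR_three]; norm_num [dataR3, Finset.sum_range_succ]
  · rw [wC_eq isDataR_three]; norm_num [dataR3, Finset.sum_range_succ]
  · rw [vC_eq isDataR_three]; norm_num [dataR3, harm, Finset.sum_range_succ]
  · rw [utC_eq isDataRt_three]; norm_num [dataRt3, Finset.sum_range_succ]
  · rw [wtC_eq isDataRt_three]; norm_num [dataRt3, Finset.sum_range_succ]
  · rw [vtC_eq isDataRt_three]; norm_num [dataRt3, harm, Finset.sum_range_succ]

/-- **(15) at `n = 3`**: `q₃ = 14290980`, `p₃ = 7682021239·(14290980/7408444032)`… i.e. `minorQ 3 = q 3`, `minorP 3 = p 3`,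
`minorPt 3 = ptilde 3` (the table row `p₃/q₃ = 7682021239/7408444032`). [cite: Zudilin2002Zeta5, Sect. 2, eq. (15) and Sect. 1 (table, n = 3)] -/
theorem eq15_three : q 3 = minorQ 3 ∧ p 3 = minorP 3 ∧ ptilde 3 = minorPt 3 := by
  obtain ⟨g1, g2, g3, g4, g5, g6⟩ := values_three
  rw [minorQ, minorP, minorPt, g1, g2, g3, g4, g5, g6]
  norm_num [q, p, ptilde, sol, rec3_step, step, a₀, a₁, a₂]

end Literature.NumberTheory.Irrationality.Zudilin2002
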